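import Mathlib
import HarnessLib
import HarnessLib.Audit
import Summits.BirchSwinnertonDyer.Statement
import Summits.BirchSwinnertonDyer.BirchSwinnertonDyer.Theses.PrintCf2
import Summits.BirchSwinnertonDyer.BirchSwinnertonDyer.Theses.CMKolyvaginAtInertTwo
import Summits.BirchSwinnertonDyer.BirchSwinnertonDyer.Theorems.PrintCf2InertTwoRankOneOfFactsGlue
import Summits.BirchSwinnertonDyer.Rank1Residual.P2.CMKolyvaginTamagawaIndexOddHeegnerBases
import Summits.BirchSwinnertonDyer.Rank1Residual.P2.CMKolyvaginOptimalPartnerAtTwo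
import Summits.BirchSwinnertonDyer.Rank1Residual.P2.CMKolyvaginShiftedSupplyAtTwo
import Summits.BirchSwinnertonDyer.Rank1Residual.P2.CMKolyvaginShiftedDescentAtTwo
import Summits.BirchSwinnertonDyer.Rank1Residual.P2.CMKolyvaginOddManinTwistRoadAtTwoClasses
import Summits.BirchSwinnertonDyer.BirchSwinnertonDyer.Theorems.ManinLocalTwoThreeMazurManinConstantOddPrimes
import Summits.BirchSwinnertonDyer.BirchSwinnertonDyer.Theorems.ManinLocalTwoThreeAbbesUllmoCesnaviciusManinConstant
import Summits.BirchSwinnertonDyer.BirchSwinnertonDyer.Theorems.PrintCf2HBMonskySelmerEven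
import HarnessLib.Audit.Status.Attr

/-!
Route: ShiftedKolyvaginAtInertTwo

# Route ShiftedKolyvaginAtInertTwo — Tamagawa-shifted refined Kolyvagin index decides the odd-inert
CM class at 2

It suffices to show X = «on the SHIFTED habitat H₂^(t) (CM by the maximal order of F with 2 INERT in
F, analytic rank 1, ρ̄_(E,2) onto GL₂(𝔽₂), EVERY lattice-optimal X₀(N)-datum having odd Manin
constant — NO Tamagawa condition), for a Heegner field K of odd discriminant ≠ −3, Kolyvagin's
Heegner system built from Kolyvagin primes that are also inert in F satisfies W. Zhang's REFINED
index identity 𝓜_∞ = t := v₂(∏_ℓ c_ℓ(E/ℚ)) (crux RefinedKolyvaginAtInertTwo), the Tamagawa-shifted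
structure theorem #Ш(E/K)[2^∞] = 2^(2(M₀ − t)) (crux ShiftedKolyvaginExactAtInertTwo), and the
shifted exact descent to BSD(E,2) through the Burungale–Flach rank-0 CM twin
(ShiftedExactDescentAtTwo, entered relative to four printed facts as the proved support
ShiftedExactDescentAtTwoOfFacts)», with the 2-part of the Manin constant on the slice `closes`
consumes (j ∈ the five odd-Heegner values, lattice-optimal datum at the conductor) a THEOREM modulo
three prints — Mazur 1978 Cor. 4.1, Abbes–Ullmo 1996 Thm A, Česnavičius 2018 Thm 1.2, entered BY
NAME as the support bundle ManinConstantPrimewisePrints (head-constant asides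
MazurManinConstantOddPrimes / AbbesUllmoManinConstantGoodPrimes / CesnaviciusManinConstantAtTwo) and
discharged inside `closes` by
`Rank1Residual.P2.OddManinTwistRoad.odd_c_of_latticeOptimal_of_j_oddHeegner` (ty2 g18,
p616713/p617449; rev 13 — the habitat-wide crux OddManinCMInertTwoR, stmt-BirchSwinnertonDyer-26780,
leaves the route: dropped rev 15, its five-j sector being exactly this theorem) — and PrintCf2's
three other classes imported BY NAME as the declared residual (PrintCf2ComplementAtTwo). X contains
PrintCf2's odd-inert class 20672 (`InertOddHeegnerJOfFacts`: every twist of 121b1, 361a1, 1849a1,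
4489a1, 26569a1) because there t ≥ 1 always (c_q = 2 at the CM prime; tree theorem
`OddHeegnerTwists.shiftedHabitat_of_j_oddHeegner`), which is exactly why the sibling route
CMKolyvaginAtInertTwo (odd Tamagawa, 𝓜_∞ = 0) cannot reach it. Realises crux idea card
tamagawa-shifted-kolyvagin (evidence on stmt-BirchSwinnertonDyer-20672).
Lean: `RefinedKolyvaginAtInertTwo → ShiftedKolyvaginExactAtInertTwo →
ShiftedExactDescentAtTwoOfFacts → PrintCf2ComplementAtTwo → ShiftedSupplyAtInertTwoOfFacts →
ModularityExistsNewform → HoffsteinLuoTwist → GrossZagierAllLevels → MilneAnyModel →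
ManinConstantPrimewisePrints → CMRankZeroBSDTriple → EntireLFunctionRat → PublishedFactsCf2 →
Summit.BirchSwinnertonDyer.WAllCornerFTwo`

## Assembly
The deciding theorem `closes` (glue.lean, kernel-checked rc 0 in the planner's sib/Sketch.lean) is:
split the residual into PrintCf2's hR/hJ0/hS and call `PrintCf2.closes hR
(Theorems.inertTwoRankOneOfFactsGlue_proof hJ0 h20672) hS hF`, where h20672 :
InertOddHeegnerJOfFacts is produced on each W with j in the five odd-Heegner values by
`OddHeegnerTwists.shiftedHabitat_of_j_oddHeegner` (CM ∧ inert ∧ onto), the odd Manin constant of the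
lattice-optimal datum Dt from `OddManinTwistRoad.odd_c_of_latticeOptimal_of_j_oddHeegner hMP.1
hMP.2.1 hMP.2.2 hmod W hj Dt hopt` (class → optimal curves via
`Rank1Residual.P2.OptimalPartner.bsdp_of_forall_optimal_of_j_oddHeegner`), the supply (K, β, ι, d₁,
M₀, twin Wd), RefinedKolyvaginAtInertTwo ((≥),(≤)), ShiftedKolyvaginExactAtInertTwo (#Ш),
`Rank1Residual.bsdp_cm_rankZero` (BSD₂ of the twin from CMRankZeroBSDTriple + EntireLFunctionRat)
and ShiftedExactDescentAtTwo (obtained from ShiftedExactDescentAtTwoOfFacts ⟨GrossZagierAllLevels,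
GZK = PublishedFactsCf2 conjunct 2, EntireLFunctionRat, MilneAnyModel⟩). Pure logic over named
theorems; 28 lines (rev 13).

CLOSES_TARGET: closes rung W-ALL/12.K12-2 of BirchSwinnertonDyer: Summit.BirchSwinnertonDyer.WAllCornerFTwo (D-0061; not the summit Statement) — the deciding theorem of this route concludes that registered leaf instead of the Statement decl `BirchSwinnertonDyer` (class rung: servable and labelled, never counted as concluding the summit Statement).

Rationale: WHY THIS LINE. Mechanism: Kolyvagin's structure theorem gives #Ш(E/K)[p^∞] = p^(2(M₀ − 𝓜_∞)) with
𝓜_∞ the minimal p-divisibility index of the derived Heegner classes (Kolyvagin1991, Gross1991); W.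
Zhang's refined conjecture 𝓜_∞ = ord_p(∏ c_ℓ) is a THEOREM for p odd, good ordinary, split
(arXiv:2312.09301 Thm 2, tree decl
`BurungaleEtAl2026.thm2_kolyvaginClass_divisibility_eq_padicValNat_tamagawaProduct`; Jetchev2008
Conj. 1.3 / Thm 1.4 gives 𝓜_∞ ≥ t; arXiv:1908.09197 Thm B and arXiv:2203.12161 Cor. 7.8 relate
primitivity to Tamagawa indivisibility). At the inert CM prime 2 the sibling route
CMKolyvaginAtInertTwo (route-BirchSwinnertonDyer-CMKolyvaginAtInertTwo, cruxes 24648/24277) runs the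
PRIMITIVE case 𝓜_∞ = 0 and therefore carries the binder `Odd W.tamagawaProduct`, which is false on
the whole odd-inert class of PrintCf2 (c_q = 2): this route replaces primitivity by the shifted
identity 𝓜_∞ = t and redoes the structure theorem and the descent with the shift, reusing verbatim
every p = 2 port the sibling's provers land (restriction-injectivity
`KolyvaginImageTwo.eq_zero_of_h1Eval_eq_zero_of_three`, Gross 9.3 at 2 p597299, Čebotarev leaf
p597930/p599084) and -ty2's kernel theorems on the class (t-criterion p597102, habitat
p597584/p597751, E(K)[2] = 0 p598005); since rev 15 the sibling's seat bsd-line-cmk2-p1 g6/g7 has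
landed the whole LEVEL-2^M toolkit on its habitat H₂ (KERNEL-STATUS-p2-port.md v6 in
Cruxes/CMExactDescentAtTwo/): restriction-injectivity and Gross 9.3 at level 2^M under the CM
commuting hypothesis hcomm (p615817; -ty2 g21 is discharging hcomm by CM theory), the Čebotarev leaf
with targets (p616952), the (−ε)-, τ- and ε-part descents (p618706, p620411, p621237), the entangled
case (p624071) and KOLYVAGIN'S ANNIHILATOR AT 2 without entanglement hypothesis
`KolyvaginDescentTwo.exists_two_pow_smul_eq_zsmul_uncond` (p625327: 2^(2M₀+2)·Sel_{2^M}(E/K) ⊆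
ℤδ(y_K) on H₂, modulo -ty2's data p601266 and hcomm) — each of which ports to the shifted habitat
once the Selmer conditions at the primes q ∣ N with even c_q carry the shift t. Imported area:
Kolyvagin-system / Selmer-structure algebra (Howard–Mazur–Rubin formalism as in arXiv:1908.09197 §2)
transplanted to p = 2 with 𝔽₄-scalars from CM; no p-adic L-function is used — none is available at p
= 2 on this habitat: the Rubin/Burungale–Kobayashi–Ota anticyclotomic theory for CM curves at INERT
p (doi:10.4007/annals.2021.194.3.8, doi:10.1017/S147474802300021X) needs p ≥ 5, its p = 3 extension
is arXiv:2401.09037, and arXiv:2203.12161 Rem. 7.10 concerns non-CM curves (wording corrected rev 4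
after tribunal T2 flag F-SKIT-4) — which is what no other route on WAllCornerFTwo or the negatives
index attempts for t ≥ 1.

RANKED CRUXES. #2 RefinedKolyvaginAtInertTwo (crux) — W. Zhang's refined Kolyvagin conjecture at the
inert CM prime 2 in point currency: on the shifted habitat, for every Heegner field K (odd d_K ≠
−3), optimal odd-Manin datum Dt, β, ι and non-torsion y_K, (≥) every derived point P_n (n ≠ 1
squarefree, Kolyvagin primes inert in F) is 2^m-divisible in E(K_n) for all m ≤ min(t, M(n)), and
(≤) some P_n with M(n) > t is not 2^(t+1)-divisible; t = v₂(∏ c_ℓ). Card item K1. [difficulty: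
open-problem] (why it might fail: Printed only for p odd good ordinary split (BCGS Thm 2 via
BDP/IMC); at inert supersingular 2 no anticyclotomic main conjecture exists, and the (≤) half is a
genuine non-vanishing statement mod 2^(t+1) that no Čebotarev argument alone forces.)
[arXiv:2312.09301, Jetchev2008, Zhang2014, arXiv:1908.09197, arXiv:2203.12161, Kolyvagin1991]
#3 ShiftedKolyvaginExactAtInertTwo (crux) — Kolyvagin's structure theorem at the inert CM prime 2,
Tamagawa-shifted (the t ≥ 0 form of the sibling's CMKolyvaginExactAtInertTwo with `Odd
W.tamagawaProduct` dropped): if y_K is exactly 2^M₀-divisible in E(K₁), every higher derived point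
is 2^min(t,M(n))-divisible and one with M(n) > t is not 2^(t+1)-divisible, then #Ш(E/K)[2^∞] =
2^(2(M₀ − t)). Card item K2. [difficulty: XL] (why it might fail — RETRIAGED rev 16 after the
sibling's kernel verdict of 2026-08-28T10:37:28Z and rev 18 after its over-ℚ template p627837:
Over-K Heegner Euler systems at 2 give an ANNIHILATOR only (sibling t=0 habitat: 2^(2M₀+2)·Sel ⊆
ℤδy_K mod hcomm, p625327), not the ORDER: τ-invariant order-2 classes res H¹(ℚ,E[2]) ∩ Sel pair
trivially with every Kolyvagin class; exactness needs an over-ℚ 2-descent complement + Cassels–Tate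
at 2. Kernel status: the pairing-form reciprocity (leaf (B) p607160), E(K[1])[2^∞] = 0 (p598005) and
the eigen-part descents ARE redone at 2 at every level 2^M (p618706–p625327); what they give is the
annihilator with an entanglement defect ≤ M₀ bits (sharp exponent M₀ + 2 open, an S/M question over
the finite group Sel^ε); what they cannot give is #(res H¹(ℚ,E[2]) ∩ Sel₂(E/K)), so the UPPER half
of the structure theorem at 2 needs a statement about classes defined over ℚ — 2-descent over ℚ /
2-class groups of the cubic field ℚ(E[2]) (BrumerKramer1977, ChaoLi2018TwoSelmer); LANDED TEMPLATE
(seat bsd-line-cmk2-p1 g8, p627837, Theorems/CMKolyvaginAtInertTwoRationalDescentAtTwo.lean):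
Poitou–Tate over ℚ with ONE exceptional place — `KolyvaginRatDescentTwo.eq_zero_or_eq_of_ratDescent`
/ `…_rat` (relaxed ⊇ strict groups S♯ ⊇ S♭ at u = (q), H¹_ur(ℚ_ℓ,E[2]) ≅ ℤ/2 pairing perfectly with
H¹_s at a Kolyvagin prime, #S♯ = #Φ_q·#S♭; hypotheses hram/hdual/hceb/hlag ⟹ Sel ⊆ {0, x}) and its
H₂ instance `selmer_two_eq_zero_or_eq_kummer_of_cmInert` (M₀ = 0, d_K = −q prime: Sel₂(E/K) ⊆ {0,
δ₂y_K} modulo the over-ℚ binders) — and the LOWER half the Cassels–Tate alternation at 2; on THIS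
habitat t ≥ 1 forces M₀ ≥ t ≥ 1, so the template must run with the 2^t-divided classes (TWO-LAYER
PLAN) and both halves carry the shift t.) [Kolyvagin1991, Gross1991, McCallumLMS1991, Zhang2014,
arXiv:1908.09197, BrumerKramer1977, ChaoLi2018TwoSelmer]
#9 ShiftedExactDescentAtTwoOfFacts (support, binder of `closes`; PROVABLE NOW) — RELATIVE shifted
exact descent: (Gross–Zagier at every level ∧ GZK rank = analytic rank ≤ 1 ∧ entire L(E/ℚ,s) ∧ Milne
1972 any-model) → ShiftedExactDescentAtTwo, i.e. on the habitat, from #Ш(E/K)[2^∞] = 2^(2(M₀ − t))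
for a Heegner datum with y_K exactly 2^M₀-divisible (t ≤ M₀) and BSD(E^K,2) for the CM
analytic-rank-0 twin (Burungale–Flach, print), conclude BSD(E,2). TURNKEY = the t-twin of
CMKolyvaginAtInertTwo's PROVED `CMExactDescentAtTwoOfFacts` (stmt-BirchSwinnertonDyer-24154, closer
`cmExactDescentAtTwo_ofFacts`): in Theorems/CMKolyvaginAtInertTwoCMExactDescentAtTwoGeneral.lean
`bsdp_two_of_card_sha_baseChange_eq_of_facts` the hypothesis `hT : Odd W.tamagawaProduct` is used
ONLY at `hvcW : padicValRat 2 c_W = 0` — replace it by t := padicValNat 2 c_W ≤ M₀ and hsha :=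
2^(2(M₀ − t)), so `hval : ord₂ q = 2(M₀ − t) = ord₂ #Ш(E_K)` and `MissingPPartOverCAt (W ⊗ K) 2` +
`AdditivePotMult.bsdp_of_pPartOverC_baseChange` conclude verbatim. The habitat statement
ShiftedExactDescentAtTwo itself (stmt-25537) is S-implied as typed (tribunal round-1 T1 finding
C_of_S) and is kept ASIDE as the named conclusion — the same move as CMK's 22837 → aside + 24154
(rev 5–6, planner g6; retriage agreed with the co-pen 2026-08-28T04:07:26Z). MilneAnyModel (= CMK
item 24149, by name, head constant) and the GZK rank fact as PublishedFactsCf2 conjunct 2 enter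
`closes` for it (rev 9; the earlier bundle ShiftedDescentInputsAtTwo was dropped). PROVED IN TREE:
item 25826 CLOSED by
`Summit.BirchSwinnertonDyer.Rank1Residual.P2.ShiftedDescent.shiftedExactDescentAtTwo_ofFacts` (ty2
g14, p607074). Card item P1. [deps: ShiftedKolyvaginExactAtInertTwo] [difficulty: S–M, mechanical]
(residual 2-adic risk, now explicit in the relative form: none beyond the four named facts — the
unit index w_K = 2, the Manin constant (odd, from the three Manin prints through
`odd_c_of_latticeOptimal_of_j_oddHeegner`, rev 13) and the Tamagawa square (∏_w c_w(E_K) = (∏ c_ℓ)²,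
JSW) are already in `shaAnOverC_baseChange_eq_of_heegner`.) [GrossZagier1986, Gross1991, Milne1972,
Miller2011LMS, doi:10.1007/BF01405086, BurungaleFlach2024]
#9 ManinConstantPrimewisePrints (support, binder hMP of `closes`, BY-NAME BUNDLE
`mazur_not_dvd_maninConstant_of_odd ∧ abbesUllmo_not_dvd_maninConstant_of_not_dvd_level ∧
cesnavicius_not_two_dvd_maninConstant_of_two_dvd_level`; its conjuncts are the head-constant asides
MazurManinConstantOddPrimes / AbbesUllmoManinConstantGoodPrimes / CesnaviciusManinConstantAtTwo —
verbatim the items of AdditiveKolyvaginRoad / ManinLocalTwoThree, count once) — the three printed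
prime-by-prime Manin-constant theorems in lattice form (Mazur 1978 Cor. 4.1: odd p, p² ∤ N;
Abbes–Ullmo 1996 Thm A: p ∤ N; Česnavičius 2018 Thm 1.2: 2 ∥ N). With modularity they yield, through
ty2 g18's landed engine `Rank1Residual.P2.OddManinTwistRoad.odd_c_of_latticeOptimal_of_j_oddHeegner`
(Rank1Residual/P2/CMKolyvaginOddManinTwistRoadAtTwo{,Classes}.lean, p616713 / p617449: every
globally minimal twist of a globally minimal base good at 2 — d ≡ 1 (4) ⇒ the twist is good at 2 ⇒
Abbes–Ullmo; otherwise d = m*·d₂ with m* ≡ 1 (4), d₂ ∈ {−1, ±2}, dyadic conductor bookkeeping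
(Barrios et al. 2025 Thm 5.1 tree theorem) and cell bsd-f2-manin's PROVED η = 2 law
`Theorems.twoNotDvdManinOfTwistOfSemistableAtTwo_holds` (Stevens 1989 (5.2)/(5.4))), `Odd Dt.c` for
EVERY lattice-optimal datum at the conductor on the five odd-Heegner classes — exactly the Manin
input `closes` needs. [difficulty: provable-now (statement-only named facts)] [Mazur1978,
AbbesUllmo1996, Cesnavicius2018, Stevens1989]
DROPPED rev 15: OddManinCMInertTwoR (stmt-BirchSwinnertonDyer-26780; the habitat-wide
lattice-optimal odd-Manin statement, rev-11 repair of the ∃-form 25414 which the referee released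
suspect-false/misstated) — no longer a binder of `closes` and no longer an item of this route (a
crux outside the cone would flip the route draft; the items cap leaves no slot; the rev-13 aside
badge did not survive re-rendering). It still implies the slice statement (honesty example in the
planner's rev-15 probe); its j ∈ five sector is the theorem above; its 27a4-twist sector (j =
−12288000) falls to the same engine with E = 27a4 (untyped, unused); its j = 0 sector beyond
Cremona's range (classes y² = x³ + k that are not dyadic twists of a 2-semistable class) is cell
bsd-f2-manin's open core `stub_twistMinimalAtTwo` — banked context, never staffed here. (why it
might still fail there: additive-at-2 optimal CM curves with 2⁴ ∣ N, N > 300000 and no 2-semistable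
twist: no printed bound on ord₂ c.) [AbbesUllmo1996, AgasheRibetStein2006,
CesnaviciusNeururerSaha2023, Mazur1978, Edixhoven1991, Cremona2022ManinConstants]

#6 PrintCf2ComplementAtTwo (crux) — RESIDUAL (imported complement, by name): PrintCf2's three other
classes of CM analytic-rank-one curves at p = 2 — ramified type (RamifiedTwoRankOneOfFacts, split
into 20509 + TYZ families), inert j = 0 (InertJZeroOfFacts, 20671) and split-bad
(SplitBadTwoRankOneOfFacts, 20368) — each relative to its published-facts bundle exactly as filed on
route PrintCf2. This route attacks the odd-inert conjunct only. [difficulty: open-problem] (why it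
might fail: Each conjunct is an open class theorem of PrintCf2 (20509 deciding there; 20368 additive
2 beyond LTYZ25; 20671 beyond SZ36/KL243); imported, not attacked here.) [LiTianYanZhu2025,
ShuZhai2021, KrizLi2019, TianYuanZhang2017]
#9 ShiftedSupplyAtInertTwoOfFacts (support) — Heegner supply on the shifted habitat RELATIVE TO
modularity, Hoffstein–Luo/BFH twist non-vanishing and Gross–Zagier at all levels: for W on the
habitat with analytic rank 1 and any optimal odd-Manin datum Dt there are a Heegner field K
(imaginary quadratic, odd d_K ≠ −3, Heegner hypothesis for N, d_K·(−|Δ|) and d_K·(−2|Δ|)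
non-squares), β, ι, a level-1 Kolyvagin–Heegner datum with y_K non-torsion and exact 2-divisibility
exponent M₀, and a globally minimal model of the twist E^K with CM and analytic rank 0. The
sibling's CMPrimitiveSupplyAtInertTwoOfFacts (24649) minus its Kolyvagin clause. PROVED IN TREE:
item 25416 CLOSED by
`Summit.BirchSwinnertonDyer.Rank1Residual.P2.ShiftedSupply.shiftedSupplyAtInertTwo_ofFacts`.
[difficulty: closed] [GrossZagier1986, HoffsteinLuo1997, BCDTJAMS2001]
#9 ModularityExistsNewform (support) — Modularity (existence of the attached newform), BY NAME —
shared verbatim with route CMKolyvaginAtInertTwo. [difficulty: provable-now] [BCDTJAMS2001]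
#9 HoffsteinLuoTwist (support) — Hoffstein–Luo / Bump–Friedberg–Hoffstein non-vanishing of quadratic
twists with prescribed local behaviour, BY NAME — shared with CMKolyvaginAtInertTwo. [difficulty:
provable-now] [HoffsteinLuo1997]
#9 GrossZagierAllLevels (support) — Gross–Zagier at all levels (named Literature fact), BY NAME —
shared with CMKolyvaginAtInertTwo. [difficulty: provable-now] [GrossZagier1986]
#9 CMRankZeroBSDTriple (support) — BSD triple for CM curves of analytic rank 0 (Rubin /
Burungale–Flach incl. p = 2), BY NAME — shared with CMKolyvaginAtInertTwo; feeds
`Rank1Residual.bsdp_cm_rankZero` for the twin. [difficulty: provable-now] [BurungaleFlach2024]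
#9 EntireLFunctionRat (support) — Entire continuation of L(E/ℚ,s) (modularity), BY NAME — shared
with CMKolyvaginAtInertTwo. [difficulty: provable-now] [BCDTJAMS2001]
#9 PublishedFactsCf2 (support) — PrintCf2's published-facts bundle 𝔅 (16 named Literature facts:
LTYZ25, GZK, modularity, Cassels, Burungale–Flach, TYZ17, Tian, Razar, LLT, M515,
Heath-Brown–Monsky, Tian S-system, Kriz–Li, Shu–Zhai ×3), BY NAME — shared verbatim with route
PrintCf2 (stmt-BirchSwinnertonDyer-20369); consumed by PrintCf2.closes. [difficulty: provable-now]
[LiTianYanZhu2025, KrizLi2019, ShuZhai2021, TianYuanZhang2017]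

TWO-LAYER PLAN. RefinedKolyvaginAtInertTwo ⇐ RefinedGe (the (≥) half: universal
2^min(t,M(n))-divisibility, Jetchev's direction) → RefinedLe (the (≤) half: one class of exact depth
t) → RefinedKolyvaginAtInertTwo (birth skeleton bc/RefinedKolyvaginAtInertTwo_birth.lean).
ShiftedKolyvaginExactAtInertTwo ⇐ ShaAnnihilator (the t-shifted twin of p625327:
2^(2(M₀−t)+2)·Sel_{2^M}(E/K) ⊆ ℤδ(y_K) from (≥), one class of exact depth t and the ported level-2^M
machine — port, not research) → TauComplement (#(res H¹(ℚ,E[2^M]) ∩ Sel) and the residual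
entanglement bits in terms of M₀ − t — the crux's real content since rev 16; TEMPLATE since rev 18 =
p627837's one-exceptional-place descent run with x = δ(z), 2^{M₀}z = y_K (z ∈ E(ℚ) mod odd index,
E^K(ℚ) ⊗ ℤ₂ = 0) and the 2^t-DIVIDED derived classes c(ℓ)/2^t: their divisibility is
RefinedKolyvaginAtInertTwo (≥), their sharp ramification at λ ⟺ z ∉ 2E(K_λ) is the divided Gross
6.2(2) = the primitivity content of (≤); the Selmer conditions at ℓ ∣ N agree over ℚ and K (Heegner:
ℓ split), so the shift enters only through the division; first rung M₀ = t at level 2 (Ш(E/K)[2] = 0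
predicted; F1's (1,0)×78 and (2,0)×48 rows are its test set), M₀ > t at level 2^M (McCallum §5 over
ℚ for E and E^K with the one-bit correction at q; CMK S7/S8 p622894); plus ONE supply input not in
the tree: a PRIME-discriminant Heegner field — the count #S♯ = #Φ_q·#S♭ is one-place, while
ShiftedSupplyAtInertTwoOfFacts rests on HL97 as typed (d ≡ 1 (8), ≤ 4 prime factors) and a composite
d_K only bounds #S♯/#S♭ by ∏#Φ_{q_i}; either (α) a k-place count closed by Cassels–Tate squareness
(k ≤ 2) or (β) a support item ShiftedSupplyPrimeDiscAtInertTwoOfFacts relative to a NAMED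
prime-twist non-vanishing print with the Heegner prescription (OnoSkinner1998 prime twists carry no
local data; Ono 2001 doi:10.1515/crll.2001.027 Thm 1 is Frobenian but twists by an even number of
primes; KrizLi2019 Thm 1.12 is Frobenian with ranks 0/1 under a 2-adic Heegner-log unit hypothesis)
— typed only when a seat holds 25528 and picks (α) or (β)) → ShaLower (#Ш[2^∞] ≥ 2^(2(M₀−t)):
Cassels–Tate alternation at 2) → equality; filed by `--split` only when a seat holds 25528.
ShiftedExactDescentAtTwoOfFacts: no split — one theorem file adapting the CMK general descent (see
#9).

KILL CRITERIA. Refutation of RefinedKolyvaginAtInertTwo on ONE habitat member (a certified Kolyvagin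
class computation showing 𝓜_∞ ≠ t, e.g. a t = 1 twist of 121b1 with a class not 2-divisible at a
level with M(n) ≥ 2, or all classes 4-divisible) closes the route
`refuted:RefinedKolyvaginAtInertTwo`. Refutation of ShiftedKolyvaginExactAtInertTwo by a member with
certified #Ш(E/K)[2^∞] ≠ 4^(M₀−t) (2-descent + Cassels–Tate) forces a pivot to a corrected exponent
(misstated) or closes it (substantive). The Manin input is no longer killable on the slice `closes`
consumes (theorem modulo the Mazur / Abbes–Ullmo / Česnavičius prints, rev 13); a refutation of the
dropped habitat-wide statement OddManinCMInertTwoR elsewhere on H₂ (j = 0 twist-minimal classes, N >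
300000) would not touch `closes`; the ∃-form OddManinCMInertTwo (25414) stays retired as misstated
(rev 11). If CMKolyvaginAtInertTwo's pen adopts the t ≥ 1 habitat, close `superseded --by` that
route. BSD is not proved by any of this.

NOT DECOMPOSED YET. The (≥)/(≤) halves of the refined identity, the annihilator / τ-complement /
lower halves of the structure theorem (TWO-LAYER PLAN; the τ-complement is the one piece no over-K
Euler-system argument supplies — its over-ℚ template is in the tree since rev 18, p627837),
E(K_n)[2] = 0 along ring class fields (done on H₂: p598005 +
`two_pow_smul_ne_of_not_divisible_ringClassField` p622628), the pairing-form reciprocity law at 2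
(Gross (4.4)/5.4(2)/6.2 at p = 2 — typed as DATA binders by -ty2 p601266 and used by leaf (B)
p607160 on H₂; the shifted habitat needs the same binders with the shift at q ∣ N) and the
Gross–Zagier 2-adic index bookkeeping are layer-2 children, filed by split only after a crux moves;
the numerical falsifier F1 (v₂[E(K):ℤy_K] ≥ t on t = 1 members) is a -p4 instrument, not an item.

CHEAPEST FALSIFIER. F1 = v₂ of the Heegner index I = [E(K) : ℤ y_K] (mod torsion) on t ≥ 1 members
of 20672 against the joint prediction of RefinedKolyvaginAtInertTwo ∧
ShiftedKolyvaginExactAtInertTwo (M₀ = v₂(I) ≥ t and #Ш_an(E/K)[2^∞] = 4^(M₀ − t), via Gross–Zagier +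
BSD-consistency): RUN by the planner (g7) as kit j303593 + j303628 (Sage 10.7, exact Heegner points
with Gross–Zagier height cross-check, globally minimal twists of the five odd-Heegner bases 121b1,
361a1, 1849a1, 4489a1, 26569a1 with |d| ≤ 200, N ≤ 300000, up to four Heegner fields each with odd
d_K ≠ −3, h_K ≤ 12): 50 habitat members (t = 1 ×31, t = 2 ×19; 24 additive at 2), 164/164 decided
(member, K) rows OK with (t, M₀ − t) = (1,0)×78, (1,1)×17, (1,2)×6, (2,0)×48, (2,1)×9, (2,2)×6 and
#Ш_an(E/K) ∈ {1, 4, 9, 16, 25, 36, 49, 81}; 15 rows NODATA (N ≥ 118336, y_K not recognised in the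
time box), 21 pairs skipped (L(E^K twin, 1) = 0), 0 KILL, 0 TENSION; calibration on non-CM
37a1/43a1/53a1/61a1/79a1/83a1 24/24 (memo F1-INSTRUMENT.md = evidence on 25411 / 25528 / 26780). ONE
member with v₂(I) < t or #Ш_an ≠ 4^(M₀−t) would have killed the pair jointly; none did. Next
cheapest: F2 = one derived class c(ℓ) of depth exactly t on a (1,1) row (121b1^(5) over ℚ(√−19): I =
4, M₀ − t = 1, Ш_an = 4) — the first instance of the (≤) half of RefinedKolyvaginAtInertTwo; the
image hypothesis H¹(K(E[2^k])/K, E[2^k]) = 0 was settled in favour from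
`KolyvaginImageTwo.eq_zero_of_h1Eval_eq_zero_of_three`.

NUMBERS. t = v₂(∏ c_ℓ) ≥ 1 on all of 20672 (c_q = 2 at the CM prime q ∈ {11, 19, 43, 67, 163}; t = 1
⟺ d q-silent, kit j297287: 12150/12150 twists); sibling habitat H₂ (t = 0) has 266 members N ≤ 30000
(kit j297169), all with j = 0 or outside the five fields; BCGS Thm 2 hypotheses: p > 3, good
ordinary, split in K, ρ̄ onto; Jetchev Thm 1.4: p odd, p ∤ N·d_K, ρ̄ onto. F1 (kit j303593/j303628):
164/164 rows M₀ ≥ t, max M₀ − t = 2, max #Ш_an(E/K) = 81, max N = 287296. Kernel at 2 on the sibling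
habitat H₂ (t = 0): annihilator exponent 2M₀ + 2 (odd p: M₀), entanglement defect ≤ M₀ bits,
information on τ-invariant order-2 Selmer classes obtainable from Kolyvagin classes of any level: 0
bits (11/11 landings of bsd-line-cmk2-p1 g7, p615817–p625327).

DEFINITION REQUESTS. None: every constant exists (`Zhang2014.levelIndex`,
`Zhang2014.IsKolyvaginPrime`, `KolyvaginHeegnerData.derivedPoint`, `ringClassField`,
`ModularParametrizationData`, `Rank1Residual.CMInert`, `AddCommGroup.primaryComponent`,
`WeierstrassCurve.sha`, PrintCf2 / CMKolyvaginAtInertTwo decls).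

Novelty: Searches (2026-08-28): lit search --hybrid "refined Kolyvagin conjecture Tamagawa divisibility p =
2" (0 at p = 2; hits BCGS arXiv:2312.09301, Jetchev arXiv:math/0703431, Zanarella arXiv:1908.09197,
Kim arXiv:2203.12161 all p odd); lit vsearch "Kolyvagin system of Heegner points divisibility index
equals Tamagawa exponent supersingular inert prime" (8 hits, none at p = 2 or CM inert); lit galaxy
search "refined Kolyvagin|Kolyvagin conjecture|Tamagawa" --star all (pdf hits = the same four + W.
Zhang 2014; no p = 2); lean search 'kolyvaginClass.*tamagawaProduct' (1: BCGS Thm 2 decl, p > 3);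
ledger negatives --problem BirchSwinnertonDyer (no Kolyvagin-index statement refuted).
Nearest prior art found: arXiv:2312.09301 Thm 2 (𝓜_∞ = ord_p ∏ c_ℓ for p > 3 good ordinary);
Jetchev2008 Thm 1.4 (𝓜_∞ ≥ ord_p ∏ c_q, p odd); in the tree
route-BirchSwinnertonDyer-CMKolyvaginAtInertTwo (the t = 0 case at inert CM 2).
Delta: the refined index identity is posed at the inert supersingular CM prime 2 and used with t ≥ 1
to decide a class (PrintCf2's 20672) on which every primitive-Kolyvagin and every p-adic-L-function
door is void.
Claimed grade: new-combination  [refs: 2312.09301, math/0703431, 1908.09197, 2203.12161, Jetchev2008]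

Barriers (technique_class: kolyvagin-systems, heegner-points, tamagawa-defect): - technique_class: kolyvagin-systems heegner-points tamagawa-defect stringent-local-conditions
gross-zagier two-part-descent
- Literature.Barriers.BirchSwinnertonDyer.StringentKolyvaginCapsAtMax: evaded on the sub-class t = 1
= max (q-silent twists, decidable by `padicValNat_two_tamagawaProduct_twist_eq_one_iff`) where "≥
max" and "= t" coincide; for t ≥ 2 it does not — the bet is that the 𝔽₄-Cartan rigidity (normal μ₃,
`KolyvaginImageTwo`) replaces the missing upper bound.
- Literature.Barriers.BirchSwinnertonDyer.NoAdmissiblePrimesCMInert: evaded — the system uses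
Kolyvagin primes inert in F (a_ℓ = 0, M(ℓ) = v₂(ℓ+1) unbounded, Dirichlet), not Zhang-admissible
level-raising primes; no bipartite system is built.
- Literature.Barriers.BirchSwinnertonDyer.EulerSystemBigImageBarrier: evaded — the image mod 2 IS
all of GL₂(𝔽₂) on the habitat (hypothesis `HasSurjectiveModNGaloisRep 2`, a theorem on 20672 by
`shiftedHabitat_of_j_oddHeegner`); 2-adically the image is the Cartan normaliser, and the only
Galois-cohomology input used (H¹(K(E[2^k])/K, E[2^k]) = 0) is proved from the normal μ₃.
- Literature.Barriers.BirchSwinnertonDyer.CMRankOneAtNonsplitTwo: it does not evade the absence of a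
2-adic L-function at inert 2; the bet is that none is needed — the route is L-function-free
(Kolyvagin system + Gross–Zagier + Burungale–Flach for the rank-0 twin).
- Literature.Barriers.BirchSwinnertonDyer.CMRankOneAtRamifiedPrime: not met — the ramified-2 CM
fields (ℚ(i), ℚ(√−2), ℚ(√−7) twists wi

History (route lifecycle, newest last):
- 2026-08-28T09:27:12Z · rev 15: restated Assembly (stmt-BirchSwinnertonDyer-26954) — rev 15 (planner g7): books ty2 g18 TURNKEY Option B — Manin input of closes := landed theorem odd_c_of_latticeOptimal_of_j_oddHeegner modulo the by-name print b (planner-bsd-print-cf2-plan-g7-0)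
- 2026-08-28T09:27:12Z · rev 15: dropped OddManinCMInertTwoR — rev 15 (planner g7): books ty2 g18 TURNKEY Option B — Manin input of closes := landed theorem odd_c_of_latticeOptimal_of_j_oddHeegner modulo the by-name print b (planner-bsd-print-cf2-plan-g7-0)
- 2026-08-28T09:28:13Z · rev 15: restated Assembly (stmt-BirchSwinnertonDyer-26954) — rev 15 (planner g7): books ty2 g18 TURNKEY Option B — Manin input of closes := landed theorem odd_c_of_latticeOptimal_of_j_oddHeegner modulo the by-name print b (planner-bsd-print-cf2-plan-g7-0)
- 2026-08-28T09:28:13Z · rev 15: dropped OddManinCMInertTwoR — rev 15 (planner g7): books ty2 g18 TURNKEY Option B — Manin input of closes := landed theorem odd_c_of_latticeOptimal_of_j_oddHeegner modulo the by-name print b (planner-bsd-print-cf2-plan-g7-0)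
- 2026-08-28T09:29:15Z · rev 15: restated Assembly (stmt-BirchSwinnertonDyer-26954) — rev 15 (planner g7): books ty2 g18 TURNKEY Option B — Manin input of closes := landed theorem odd_c_of_latticeOptimal_of_j_oddHeegner modulo the by-name print b (planner-bsd-print-cf2-plan-g7-0)
- 2026-08-28T09:29:15Z · rev 15: dropped OddManinCMInertTwoR — rev 15 (planner g7): books ty2 g18 TURNKEY Option B — Manin input of closes := landed theorem odd_c_of_latticeOptimal_of_j_oddHeegner modulo the by-name print b (planner-bsd-print-cf2-plan-g7-0)
- 2026-08-28T09:30:16Z · rev 15: restated Assembly (stmt-BirchSwinnertonDyer-26954) — rev 15 (planner g7): books ty2 g18 TURNKEY Option B — Manin input of closes := landed theorem odd_c_of_latticeOptimal_of_j_oddHeegner modulo the by-name print b (planner-bsd-print-cf2-plan-g7-0)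
- 2026-08-28T09:30:16Z · rev 15: dropped OddManinCMInertTwoR — rev 15 (planner g7): books ty2 g18 TURNKEY Option B — Manin input of closes := landed theorem odd_c_of_latticeOptimal_of_j_oddHeegner modulo the by-name print b (planner-bsd-print-cf2-plan-g7-0)

sub-problem: BirchSwinnertonDyer · status: open · opened planner-bsd-print-cf2-plan-g5-0 2026-08-28T03:39:36Z · rev 19 · ledger route-BirchSwinnertonDyer-ShiftedKolyvaginAtInertTwo
GENERATED by the gate from the ledger (D-0016/17). Provers cite these decls: `theorem foo : Summit.BirchSwinnertonDyer.BirchSwinnertonDyer.Theses.ShiftedKolyvaginAtInertTwo.<Decl> := …` in Summits/BirchSwinnertonDyer/BirchSwinnertonDyer/Theorems/<Name>.lean.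
-/

namespace Summit.BirchSwinnertonDyer.BirchSwinnertonDyer.Theses.ShiftedKolyvaginAtInertTwo

open scoped BigOperators Topology Manifold Classical MeasureTheory ProbabilityTheory Matrix InnerProductSpace ComplexConjugate ContinuousMap
open Filter Set Function TopologicalSpace MeasureTheory

attribute [summit_statement] _root_.BirchSwinnertonDyer
attribute [summit_statement] _root_.Summit.BirchSwinnertonDyer.WAllCornerFTwo

open Literature

/-- item stmt-BirchSwinnertonDyer-25411 · crux · rank 2 · open · by planner
why it might fail: Printed only for p odd good ordinary split (BCGS Thm 2 via BDP/IMC); at inert supersingular 2 no anticyclotomic main conjecture exists, and the (≤) half is a genuine non-vanishing statement mod 2^(t+1) that no Čebotarev argument alone forces.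
sources: arXiv:2312.09301, Jetchev2008, Zhang2014, arXiv:1908.09197, arXiv:2203.12161, Kolyvagin1991
[crux] W. Zhang's refined Kolyvagin conjecture at the inert CM prime 2 in point currency: on the
shifted habitat, for every Heegner field K (odd d_K ≠ −3), optimal odd-Manin datum Dt, β, ι and
non-torsion y_K, (≥) every derived point P_n (n ≠ 1 squarefree, Kolyvagin primes inert in F) is
2^m-divisible in E(K_n) for all m ≤ min(t, M(n)), and (≤) some P_n with M(n) > t is not
2^(t+1)-divisible; t = v₂(∏ c_ℓ). Card item K1. [difficulty: open-problem] -/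
@[route_item "route-BirchSwinnertonDyer-ShiftedKolyvaginAtInertTwo", crux]
def RefinedKolyvaginAtInertTwo : Prop :=
  ∀ (W : WeierstrassCurve ℚ) [W.IsElliptic] [W.IsGloballyMinimal] [NeZero (W.conductorNorm ℤ)], W.HasCM → Literature.NumberTheory.EllipticCurves.Rank1Residual.CMInert W 2 → W.HasSurjectiveModNGaloisRep (2 : ℤ) → W.analyticRank = 1 → ∀ (K : Type) [Field K] [NumberField K], Literature.NumberTheory.EllipticCurves.IsImaginaryQuadratic K → Odd (NumberField.discr K) → NumberField.discr K ≠ -3 → Literature.NumberTheory.EllipticCurves.SatisfiesHeegnerHypothesis (W.conductorNorm ℤ) K → ∀ (Dt : Literature.NumberTheory.EllipticCurves.ModularForms.ModularParametrizationData W (W.conductorNorm ℤ)), (∀ z ∈ Dt.L.lattice, ∃ w ∈ Literature.NumberTheory.EllipticCurves.ModularForms.periodLattice Dt.f, z = (Dt.c : ℂ) * w) → Odd Dt.c → ∀ (β : ℤ) (ι : K →+* ℂ) (d₁ : Literature.NumberTheory.EllipticCurves.KolyvaginHeegnerData Dt β ι 1), ¬ IsOfFinAddOrder d₁.derivedPoint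 → (∀ (n : ℕ) (d : Literature.NumberTheory.EllipticCurves.KolyvaginHeegnerData Dt β ι n) (m : ℕ), Squarefree n → n ≠ 1 → (∀ ℓ ∈ n.primeFactors, (Literature.NumberTheory.EllipticCurves.Zhang2014.IsKolyvaginPrime (W.conductorNorm ℤ) W K 2 ℓ ∧ Literature.NumberTheory.EllipticCurves.Rank1Residual.CMInert W ℓ)) → (m : ℕ∞) ≤ Literature.NumberTheory.EllipticCurves.Zhang2014.levelIndex W 2 n → m ≤ padicValNat 2 W.tamagawaProduct → ∃ Q : (W.baseChange (Literature.NumberTheory.EllipticCurves.ringClassField K ι n)).toAffine.Point, ((2 ^ m : ℕ) : ℤ) • Q = d.derivedPoint) ∧ (∃ (n : ℕ) (d : Literature.NumberTheory.EllipticCurves.KolyvaginHeegnerData Dt β ι n), Squarefree n ∧ (∀ ℓ ∈ n.primeFactors, (Literature.NumberTheory.EllipticCurves.Zhang2014.IsKolyvaginPrime (W.conductorNorm ℤ) W K 2 ℓ ∧ Literature.NumberTheory.EllipticCurves.Rank1Residual.CMInert W ℓ)) ∧ ((padicValNat 2 W.tamagawaProduct : ℕ) : ℕ∞) < Literature.NumberTheory.EllipticCurves.Zhang2014.levelIndex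 W 2 n ∧ ¬ ∃ Q : (W.baseChange (Literature.NumberTheory.EllipticCurves.ringClassField K ι n)).toAffine.Point, ((2 ^ (padicValNat 2 W.tamagawaProduct + 1) : ℕ) : ℤ) • Q = d.derivedPoint)

-- earlier ShiftedKolyvaginExactAtInertTwo (stmt-BirchSwinnertonDyer-25412, replaced 2026-08-28T03:53:33Z -> stmt-BirchSwinnertonDyer-25528): retired by None — ∀ (W : WeierstrassCurve ℚ) [W.IsElliptic] [W.IsGloballyMinimal] [NeZero (W.conductorNorm ℤ)], W.HasCM → Literature.NumberTheory.EllipticCurves.Rank1Residual.CMInert W 2 → W.HasSurjectiveModNGaloisRep (2 : ℤ) → ∀ (K : Type) [Field K] [NumberFie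
/-- item stmt-BirchSwinnertonDyer-25528 · crux · rank 3 · open · by planner
why it might fail: Over-K Euler systems at 2 give only an annihilator (p625327); the τ-invariant ORDER needs over-ℚ descent: template landed at M₀=0 on H₂ (KolyvaginRatDescentTwo…of_cmInert, p627837; ONE ramified prime d_K=−q); at t≥1: 2^t-divided classes, a prime-d_K supply beyond HL97 as typed, Cassels–Tate at 2.
sources: Kolyvagin1991, Gross1991, McCallumLMS1991, Kolyvagin1989Izv, Kramer1981, Jetchev2008
[crux] Kolyvagin's structure theorem at the inert CM prime 2, Tamagawa-shifted (the t ≥ 0 form of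
the sibling's CMKolyvaginExactAtInertTwo with `Odd W.tamagawaProduct` dropped): if y_K is exactly
2^M₀-divisible in E(K₁), every higher derived point is 2^min(t,M(n))-divisible and one with M(n) > t
is not 2^(t+1)-divisible, then #Ш(E/K)[2^∞] = 2^(2(M₀ − t)). Card item K2. [difficulty: XL] -/
@[route_item "route-BirchSwinnertonDyer-ShiftedKolyvaginAtInertTwo", crux]
def ShiftedKolyvaginExactAtInertTwo : Prop :=
  ∀ (W : WeierstrassCurve ℚ) [W.IsElliptic] [W.IsGloballyMinimal] [NeZero (W.conductorNorm ℤ)], W.HasCM → Literature.NumberTheory.EllipticCurves.Rank1Residual.CMInert W 2 → W.HasSurjectiveModNGaloisRep (2 : ℤ) → ∀ (K : Type) [Field K] [NumberField K], Literature.NumberTheory.EllipticCurves.IsImaginaryQuadratic K → Odd (NumberField.discr K) → NumberField.discr K ≠ -3 → Literature.NumberTheory.EllipticCurves.SatisfiesHeegnerHypothesis (W.conductorNorm ℤ) K → ¬ IsSquare ((NumberField.discr K : ℚ) * -|W.Δ|) → ¬ IsSquare ((NumberField.discr K : ℚ) * (-(2 * |W.Δ|))) → ∀ (Dt : Literature.NumberTheory.EllipticCurves.ModularForms.ModularParametrizationData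 W (W.conductorNorm ℤ)) (β : ℤ) (ι : K →+* ℂ) (d₁ : Literature.NumberTheory.EllipticCurves.KolyvaginHeegnerData Dt β ι 1), ¬ IsOfFinAddOrder d₁.derivedPoint → ∀ (M₀ : ℕ), (∃ Q : (W.baseChange (Literature.NumberTheory.EllipticCurves.ringClassField K ι 1)).toAffine.Point, ((2 ^ M₀ : ℕ) : ℤ) • Q = d₁.derivedPoint) → (¬ ∃ Q : (W.baseChange (Literature.NumberTheory.EllipticCurves.ringClassField K ι 1)).toAffine.Point, ((2 ^ (M₀ + 1) : ℕ) : ℤ) • Q = d₁.derivedPoint) → (∀ (n : ℕ) (d : Literature.NumberTheory.EllipticCurves.KolyvaginHeegnerData Dt β ι n) (m : ℕ), Squarefree n → n ≠ 1 → (∀ ℓ ∈ n.primeFactors, (Literature.NumberTheory.EllipticCurves.Zhang2014.IsKolyvaginPrime (W.conductorNorm ℤ) W K 2 ℓ ∧ Literature.NumberTheory.EllipticCurves.Rank1Residual.CMInert W ℓ)) → (m : ℕ∞) ≤ Literature.NumberTheory.EllipticCurves.Zhang2014.levelIndex W 2 n → m ≤ padicValNat 2 W.tamagawaProduct → ∃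 Q : (W.baseChange (Literature.NumberTheory.EllipticCurves.ringClassField K ι n)).toAffine.Point, ((2 ^ m : ℕ) : ℤ) • Q = d.derivedPoint) → ∀ (n : ℕ) (d : Literature.NumberTheory.EllipticCurves.KolyvaginHeegnerData Dt β ι n), Squarefree n → (∀ ℓ ∈ n.primeFactors, (Literature.NumberTheory.EllipticCurves.Zhang2014.IsKolyvaginPrime (W.conductorNorm ℤ) W K 2 ℓ ∧ Literature.NumberTheory.EllipticCurves.Rank1Residual.CMInert W ℓ)) → ((padicValNat 2 W.tamagawaProduct : ℕ) : ℕ∞) < Literature.NumberTheory.EllipticCurves.Zhang2014.levelIndex W 2 n → (¬ ∃ Q : (W.baseChange (Literature.NumberTheory.EllipticCurves.ringClassField K ι n)).toAffine.Point, ((2 ^ (padicValNat 2 W.tamagawaProduct + 1) : ℕ) : ℤ) • Q = d.derivedPoint) → (padicValNat 2 W.tamagawaProduct ≤ M₀ ∧ Nat.card (AddCommGroup.primaryComponent (W.baseChange K).sha 2) = 2 ^ (2 * (M₀ - padicValNat 2 W.tamagawaProduct)))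

/-- item stmt-BirchSwinnertonDyer-25415 · crux · rank 6 · open · by planner
why it might fail: Each conjunct is an open class theorem of PrintCf2 (20509 deciding there; 20368 additive 2 beyond LTYZ25; 20671 beyond SZ36/KL243); imported, not attacked here.
sources: LiTianYanZhu2025, ShuZhai2021, KrizLi2019, TianYuanZhang2017
[crux] RESIDUAL (imported complement, by name): PrintCf2's three other classes of CM
analytic-rank-one curves at p = 2 — ramified type (RamifiedTwoRankOneOfFacts, split into 20509 + TYZ
families), inert j = 0 (InertJZeroOfFacts, 20671) and split-bad (SplitBadTwoRankOneOfFacts, 20368) —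
each relative to its published-facts bundle exactly as filed on route PrintCf2. This route attacks
the odd-inert conjunct only. [difficulty: open-problem] -/
@[route_item "route-BirchSwinnertonDyer-ShiftedKolyvaginAtInertTwo", crux]
def PrintCf2ComplementAtTwo : Prop :=
  Summit.BirchSwinnertonDyer.BirchSwinnertonDyer.Theses.PrintCf2.RamifiedTwoRankOneOfFacts ∧ Summit.BirchSwinnertonDyer.BirchSwinnertonDyer.Theses.PrintCf2.InertJZeroOfFacts ∧ Summit.BirchSwinnertonDyer.BirchSwinnertonDyer.Theses.PrintCf2.SplitBadTwoRankOneOfFacts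

-- earlier ShiftedExactDescentAtTwo (stmt-BirchSwinnertonDyer-25413, replaced 2026-08-28T03:54:59Z -> stmt-BirchSwinnertonDyer-25537): retired by None — ∀ (W : WeierstrassCurve ℚ) [W.IsElliptic] [W.IsGloballyMinimal] [NeZero (W.conductorNorm ℤ)], W.HasCM → Literature.NumberTheory.EllipticCurves.Rank1Residual.CMInert W 2 → W.HasSurjectiveModNGaloisRep (2 : ℤ) → W.analyticRank = 1 → ∀ (K : Type) [Field
/-- item stmt-BirchSwinnertonDyer-25537 · support · rank 4 · open · by planner
why it might fail: Even twists (2 ∣ N, additive at 2): Milne's any-model comparison and the Kramer–Tunnell local norm index at 2 must come out with exactly the shift 2t; a stray factor 2 from the real period or E(ℚ₂)-component group on the five bases breaks the equality.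
sources: Milne1972, GrossZagier1986, Miller2011LMS
[crux] Shifted exact descent: on the habitat, from #Ш(E/K)[2^∞] = 2^(2(M₀ − t)) for a Heegner datum
with y_K exactly 2^M₀-divisible, and BSD(E^K,2) for the CM analytic-rank-0 twin (Burungale–Flach,
print), conclude BSD(E,2) — the t-twin of the sibling's CMExactDescentAtTwo (t = 0, PROVED as
cmExactDescentAtTwoOfFacts_proof) with the Tamagawa factor 2^t no longer cancelling in the
Gross–Zagier/BSD quotient. Card item P1. [deps: ShiftedKolyvaginExactAtInertTwo] [difficulty: L] -/
@[route_item "route-BirchSwinnertonDyer-ShiftedKolyvaginAtInertTwo"]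
def ShiftedExactDescentAtTwo : Prop :=
  ∀ (W : WeierstrassCurve ℚ) [W.IsElliptic] [W.IsGloballyMinimal] [NeZero (W.conductorNorm ℤ)], W.HasCM → Literature.NumberTheory.EllipticCurves.Rank1Residual.CMInert W 2 → W.HasSurjectiveModNGaloisRep (2 : ℤ) → W.analyticRank = 1 → ∀ (K : Type) [Field K] [NumberField K], Literature.NumberTheory.EllipticCurves.IsImaginaryQuadratic K → Odd (NumberField.discr K) → NumberField.discr K ≠ -3 → Literature.NumberTheory.EllipticCurves.SatisfiesHeegnerHypothesis (W.conductorNorm ℤ) K → ∀ (Dt : Literature.NumberTheory.EllipticCurves.ModularForms.ModularParametrizationData W (W.conductorNorm ℤ)), (∀ z ∈ Dt.L.lattice, ∃ w ∈ Literature.NumberTheory.EllipticCurves.ModularForms.periodLattice Dt.f, z = (Dt.c : ℂ) * w) → Odd Dt.c → ∀ (β : ℤ) (ι : K →+* ℂ) (d₁ : Literature.NumberTheory.EllipticCurves.KolyvaginHeegnerData Dt β ι 1), ¬ IsOfFinAddOrder d₁.derivedPoint → ∀ (M₀ : ℕ), (∃ Q : (W.baseChange (Literature.NumberTheory.EllipticCurves.ringClassField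 K ι 1)).toAffine.Point, ((2 ^ M₀ : ℕ) : ℤ) • Q = d₁.derivedPoint) → (¬ ∃ Q : (W.baseChange (Literature.NumberTheory.EllipticCurves.ringClassField K ι 1)).toAffine.Point, ((2 ^ (M₀ + 1) : ℕ) : ℤ) • Q = d₁.derivedPoint) → padicValNat 2 W.tamagawaProduct ≤ M₀ → Nat.card (AddCommGroup.primaryComponent (W.baseChange K).sha 2) = 2 ^ (2 * (M₀ - padicValNat 2 W.tamagawaProduct)) → ∀ (Wd : WeierstrassCurve ℚ) [Wd.IsElliptic] [Wd.IsGloballyMinimal], (∃ C : WeierstrassCurve.VariableChange ℚ, C • W.quadraticTwist (NumberField.discr K : ℚ) = Wd) → Literature.NumberTheory.EllipticCurves.BSDp Wd 2 → Literature.NumberTheory.EllipticCurves.BSDp W 2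

/-- item stmt-BirchSwinnertonDyer-19141 · aside · rank 9 · open · by operator
sources: LiTianYanZhu2025, doi:10.4310/pamq.251115004959
[support, PRINTED — closes only by formalising the source; carried as a hypothesis exactly like
PublishedFactsAllTwists] Li–Tian–Yan–Zhu 2025 (PAMQ 21, doi:10.4310/pamq.251115004959) Thm. 1.1: the
p-part of the BSD formula for CM elliptic curves E/ℚ of analytic rank 1 at every prime p (p split in
K if p ≠ 2; good ordinary at p if p = 2) — the tree's cite-tagged Literature Prop, by name. It is
the GOOD cell of the parent twin (tree theorem bsdTwo_cmSplit_goodCell_of_thm11, file 13). -/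
@[route_item "route-BirchSwinnertonDyer-ShiftedKolyvaginAtInertTwo"]
def LTYZThm11CMRankOnePPart : Prop :=
  Literature.NumberTheory.EllipticCurves.LiTianYanZhu2025.thm11_bsdp_of_cm_rank_one

/-- item stmt-BirchSwinnertonDyer-19273 · support · rank 9 · open · by planner
sources: BCDTJAMS2001
[support] entire continuation of L(E/ℚ, s) (modularity: Breuil–Conrad–Diamond–Taylor 2001 Thm A +
Hecke/Shimura), BY NAME — conjunct of MultConversePublishedInputsAtTwo (19185); same content, filed
so the head constant is item-stated (#15c one rule; cite_only dep) -/
@[route_item "route-BirchSwinnertonDyer-ShiftedKolyvaginAtInertTwo", crux]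
def EntireLFunctionRat : Prop :=
  WeierstrassCurve.hasEntireLFunction_rat

/-- item stmt-BirchSwinnertonDyer-19307 · aside · rank 9 · open · by operator
sources: Cassels1965, Milne1986ADT
[support] Cassels 1965 (Arithmetic on curves of genus 1, VIII; J. reine angew. Math. 217) / Milne
ADT Thm I.7.3 and Rem I.7.4: the BSD quotient (right-hand side of the BSD formula) is invariant
under isogeny over ℚ — conjunct of the support PrintedFacts (stmt-BirchSwinnertonDyer-19362), BY
NAME; same content, filed as a split child so the head constant is item-stated (gate5 #15c one rule;
readiness rule 2026-08-15: cite_only dep declared by the route; director-bsd 2026-08-26T04:22Z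
«K3/E2 shape»); no crux statement / closes / tribunal change -/
@[route_item "route-BirchSwinnertonDyer-ShiftedKolyvaginAtInertTwo"]
def BSDQuotientIsogenyInvariance : Prop :=
  WeierstrassCurve.bsdRHS_eq_of_isIsogenous

/-- item stmt-BirchSwinnertonDyer-19372 · support · rank 9 · open · by planner
sources: HoffsteinLuo1997
[aside] Hoffstein–Luo 1997 Theorem (§1, pp. 435–436), as used in Matsuno 2009 proof of Prop. 6.1: a
quadratic twist with L(E^D,1) ≠ 0 under prescribed local conditions — conjunct of
PublishedInputsFive (stmt-BirchSwinnertonDyer-19066) kept inside the k = 7 rest child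
ClassicalAndTwistInputsFive and item-stated here BY NAME as an ASIDE (banked context, never staffed,
BC6-exempt) so the cite_only dep is declared (#15c); no crux statement / closes / tribunal change -/
@[route_item "route-BirchSwinnertonDyer-ShiftedKolyvaginAtInertTwo", crux]
def HoffsteinLuoTwist : Prop :=
  Literature.NumberTheory.EllipticCurves.HoffsteinLuo1997_exists_twist_L_one_ne_zero

/-- item stmt-BirchSwinnertonDyer-19382 · support · rank 9 · open · by planner
sources: BCDTJAMS2001
[support] Modularity Theorem, Version L (Diamond–Shurman 2005 Thm. 8.8.3; Wiles / Taylor–Wiles /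
BCDT 2001 Thm. A): every E/ℚ has a weight-2 newform f of level N_E with L(f,s) = L(E,s) — conjunct
of PublishedInputsFive (stmt-BirchSwinnertonDyer-19066), BY NAME; same content, filed as a split
child so the head constant is item-stated (gate5 #15c one rule / readiness rule 2026-08-15: a
cite_only dep must be declared by the route); no crux statement / closes / tribunal / tribunal_fit
change -/
@[route_item "route-BirchSwinnertonDyer-ShiftedKolyvaginAtInertTwo", crux]
def ModularityExistsNewform : Prop :=
  Literature.NumberTheory.EllipticCurves.ModularForms.exists_isNewformOf

/-- item stmt-BirchSwinnertonDyer-19383 · aside · rank 9 · closed · proved by Summit.BirchSwinnertonDyer.BirchSwinnertonDyer.Theorems.ManinLocalTwoThree.MazurManinConstantOddPrimes_proof (prover) · by planner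
why it might fail: Printed theorem (Mazur 1978 Cor. 4.1; reproved Česnavičius 2018 §1 (MK-1)); stated verbatim in lattice form — fails only if the lattice rendering mis-transcribes the optimality hypothesis.
sources: Mazur1978, Cesnavicius2018, Edixhoven1991
[support] Mazur 1978 Cor. 4.1 (with Edixhoven 1991 Prop. 2: c ∈ ℤ): for every odd prime p with p² ∤
N the Manin constant is prime to p — conjunct of PublishedInputsFive
(stmt-BirchSwinnertonDyer-19066), BY NAME; same content, filed as a split child so the head constant
is item-stated (gate5 #15c one rule / readiness rule 2026-08-15: a cite_only dep must be declared by
the route); no crux statement / closes / tribunal / tribunal_fit change -/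
@[route_item "route-BirchSwinnertonDyer-ShiftedKolyvaginAtInertTwo"]
def MazurManinConstantOddPrimes : Prop :=
  Literature.NumberTheory.EllipticCurves.ModularForms.mazur_not_dvd_maninConstant_of_odd

/-- `MazurManinConstantOddPrimes` holds: proved by `Summit.BirchSwinnertonDyer.BirchSwinnertonDyer.Theorems.ManinLocalTwoThree.MazurManinConstantOddPrimes_proof`. -/
theorem MazurManinConstantOddPrimes_holds : MazurManinConstantOddPrimes := _root_.Summit.BirchSwinnertonDyer.BirchSwinnertonDyer.Theorems.ManinLocalTwoThree.MazurManinConstantOddPrimes_proof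

/-- item stmt-BirchSwinnertonDyer-19423 · support · rank 9 · open · by planner
sources: BurungaleFlach2024
[support, cite-level BY-NAME ALIAS of a published input — never a prover target; held]
Burungale–Flach 2024 Thm. 1.1 + Cor. 2 (with Rubin 1991 Thm. 12.3 at p ∤ #O_K^×): the full BSD
formula for CM elliptic curves over ℚ with L(E,1) ≠ 0 at EVERY prime p. Conjunct 2 of
`PublishedInputsFineSelmerCM` (stmt 19387; closes the CM rows of the U₀-ns child); filed under this
split ONLY to item-state the constant (unused by the glue). -/
@[route_item "route-BirchSwinnertonDyer-ShiftedKolyvaginAtInertTwo", crux]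
def CMRankZeroBSDTriple : Prop :=
  Literature.NumberTheory.EllipticCurves.bsdTriple_of_hasCM_of_L_one_ne_zero

/-- item stmt-BirchSwinnertonDyer-19921 · aside · rank 9 · open · by operator
sources: GrossZagier1986, Kolyvagin1990
[support] The one PUBLISHED input the halves-glue consumes: Gross–Zagier–Kolyvagin, rank = analytic
rank for analytic rank ≤ 1 with Ш finite (tree named fact
rank_eq_analyticRank_of_analyticRank_le_one; used by bsdp_of_missingPPartAt to turn Miller's last
clause into BSD(E,2)). Carried as a displayed PUB hypothesis; never counted as progress. The further
PRINT of the roads to the two halves (Greenberg Thm-4.1 analogues at a multiplicative prime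
thm41Analogue_charValue_rankZero_numberField_anyPrime / …_split_baseChange_anyPrime, modularity) and
the referee-passed MEMO inputs (Kato ⊗ℚ at a multiplicative 2:
X5.O1.KatoMultiplicativeDivisibilityRat W 2, HOME mult/PROOF-MULT.md RC-2; Greenberg–Stevens at 2:
greenberg_stevens W 2, mult/PROOF-GS2.md RC-4) enter the LINES under the halves (bridge
multiplicativeRankZeroAtTwo_of_muRoad, p409679), not this glue. -/
@[route_item "route-BirchSwinnertonDyer-ShiftedKolyvaginAtInertTwo"]
def RankEqAnalyticRankLeOne : Prop :=
  Literature.NumberTheory.EllipticCurves.rank_eq_analyticRank_of_analyticRank_le_one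

/-- item stmt-BirchSwinnertonDyer-20090 · aside · rank 9 · closed · proved by Summit.BirchSwinnertonDyer.BirchSwinnertonDyer.Theorems.ManinLocalTwoThree.AbbesUllmoManinConstantGoodPrimes_proof (prover) · by planner
why it might fail: Printed theorem (Abbes–Ullmo 1996 Thm A: p ∤ N ⇒ p ∤ c for the optimal curve); lattice rendering verbatim — fails only by mis-transcription of the optimality hypothesis.
sources: AbbesUllmo1996, Cesnavicius2018
[support] BY NAME, cite_only input: Abbes–Ullmo 1996 Thm A — for the lattice-optimal datum and p ∤
N, p ∤ c (`abbesUllmo_not_dvd_maninConstant_of_not_dvd_level`); consumed by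
`not_dvd_maninConstant_of_kodairaSymbolAt_eq_Istar`. [difficulty: hypothesis-only] -/
@[route_item "route-BirchSwinnertonDyer-ShiftedKolyvaginAtInertTwo"]
def AbbesUllmoManinConstantGoodPrimes : Prop :=
  Literature.NumberTheory.EllipticCurves.ModularForms.abbesUllmo_not_dvd_maninConstant_of_not_dvd_level

/-- `AbbesUllmoManinConstantGoodPrimes` holds: proved by `Summit.BirchSwinnertonDyer.BirchSwinnertonDyer.Theorems.ManinLocalTwoThree.AbbesUllmoManinConstantGoodPrimes_proof`. -/
theorem AbbesUllmoManinConstantGoodPrimes_holds : AbbesUllmoManinConstantGoodPrimes := _root_.Summit.BirchSwinnertonDyer.BirchSwinnertonDyer.Theorems.ManinLocalTwoThree.AbbesUllmoManinConstantGoodPrimes_proof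

/-- item stmt-BirchSwinnertonDyer-20091 · aside · rank 9 · open · by planner
why it might fail: Printed theorem (Česnavičius 2018 Thm 1.2: 2 ∥ N ⇒ 2 ∤ c); lattice rendering verbatim — fails only by mis-transcription.
sources: Cesnavicius2018, AgasheRibetStein2006
[support] BY NAME, cite_only input: Česnavičius 2018 Thm 1.2 (2 ∥ N ⇒ 2 ∤ c for the lattice-optimal
datum; `cesnavicius_not_two_dvd_maninConstant_of_two_dvd_level`) — a hypothesis of the tree theorem
`not_dvd_maninConstant_of_kodairaSymbolAt_eq_Istar` as typed (its semistable-twist step is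
prime-uniform); not used at the odd p of this route otherwise. [difficulty: hypothesis-only] -/
@[route_item "route-BirchSwinnertonDyer-ShiftedKolyvaginAtInertTwo"]
def CesnaviciusManinConstantAtTwo : Prop :=
  Literature.NumberTheory.EllipticCurves.ModularForms.cesnavicius_not_two_dvd_maninConstant_of_two_dvd_level

/-- item stmt-BirchSwinnertonDyer-20369 · support · rank 9 · open · by planner
sources: LiTianYanZhu2025, KrizLi2019, ShuZhai2021, TianYuanZhang2017
[support] the published input consumed by `closes`, by name: Li–Tian–Yan–Zhu 2025 Thm 1.1 (ii)
(`thm11_bsdp_of_cm_rank_one`, hypotheses verbatim: CM, analytic rank one, p split in K, good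
ordinary at p when p = 2) AND the union 𝔅 of the three crux bundles (GZK, modularity, Cassels, CM
rank-0 BSD, TYZ17 Thm 1.2′, Tian14 Thm 1.3, Rédei–Reichardt, LLT24 Thm 1.2, Monsky Cor 5.15 (2),
Heath-Brown–Monsky even, Tian 𝒮⁻ system, Kriz–Li Thm 1.12, Shu–Zhai Thm 1.2/1.4/4.10) — 16 PUBLISHED
named facts, statement-only with cite tags; `closes` destructures it and hands each crux its
sub-bundle. Never proved here. [difficulty: provable-now] -/
@[route_item "route-BirchSwinnertonDyer-ShiftedKolyvaginAtInertTwo", crux]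
def PublishedFactsCf2 : Prop :=
  Literature.NumberTheory.EllipticCurves.LiTianYanZhu2025.thm11_bsdp_of_cm_rank_one ∧ Literature.NumberTheory.EllipticCurves.rank_eq_analyticRank_of_analyticRank_le_one ∧ WeierstrassCurve.hasEntireLFunction_rat ∧ WeierstrassCurve.bsdRHS_eq_of_isIsogenous ∧ Literature.NumberTheory.EllipticCurves.bsdTriple_of_hasCM_of_L_one_ne_zero ∧ Literature.NumberTheory.EllipticCurves.TianYuanZhang2017.thm12_parity_of_scriptL' ∧ Literature.NumberTheory.EllipticCurves.Tian2014.thm13_rank_one_and_sha_odd ∧ Literature.NumberTheory.QuadraticFields.RedeiReichardt.redeiReichardt_fourTwoCard_classGroup ∧ Literature.NumberTheory.EllipticCurves.LiLiuTian2024.thm12_bsd_congruentNumberCurve ∧ Literature.NumberTheory.EllipticCurves.Monsky1990.cor515_rank_eq_one_and_card_selmerGroup_two ∧ Literature.NumberTheory.EllipticCurves.HeathBrown1994.monsky_card_selmerGroup_two_even ∧ Literature.NumberTheory.EllipticCurves.Tian2014.tian2014_system_sMinus_genus ∧ Literature.NumberTheory.EllipticCurves.KrizLi2019.thm112_bsdTwo_twist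 ∧ Literature.NumberTheory.EllipticCurves.ShuZhai2021.thm12_ranks_of_twists ∧ Literature.NumberTheory.EllipticCurves.ShuZhai2021.thm14_twoPartBSD_of_twists ∧ Literature.NumberTheory.EllipticCurves.ShuZhai2021.thm410_twoAdicValuations_of_twists

/-- item stmt-BirchSwinnertonDyer-20584 · aside · rank 9 · open · by planner
sources: TianYuanZhang2017
[aside] Tian–Yuan–Zhang 2017 Thm 1.2 AS PRINTED (genus-periods parity of the normalised derivative
𝓛′ for E_n; DOSSIER §3/§12 row hTYZ′: VERBATIM), conjunct 5 of 𝔅_ram (RamifiedTwoRankOneOfFacts /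
20508 / 20509 / asides 20470, 20471) — consumed by p1's closers
`…wAllCornerFTwoRamifiedTYZProved_of_facts (h12' …)` and `…TYZAtlasFJ_of_facts (h12' hGZK)`.
item-stated BY NAME so the route's dependency cone is declared (gate staffable rule 2026-08-15;
director-bsd 2026-08-27T14:28:55Z/14:35:50Z remedy (i); PrintCFram/PrintX9/SOED precedent): banked
context, never staffed, BC6-exempt, closes only by formalisation; no crux statement / closes /
tribunal change. -/
@[route_item "route-BirchSwinnertonDyer-ShiftedKolyvaginAtInertTwo"]
def TYZParityOfScriptLPrime : Prop :=
  Literature.NumberTheory.EllipticCurves.TianYuanZhang2017.thm12_parity_of_scriptL'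

/-- item stmt-BirchSwinnertonDyer-20585 · aside · rank 9 · open · by planner
sources: Tian2014
[aside] Tian 2014 (Camb. J. Math. 2) Thm 1.3 AS PRINTED: the congruent-number curves E_n of the
theorem's residue/genus classes have ord_{s=1} = 1 = rank and #Ш odd (DOSSIER §2/§12 row hT13:
VERBATIM), conjunct 6 of 𝔅_ram — consumed by p1's `…TYZProved_of_facts (… h13 …)` (Tian classes 5/7)
and the U⁺ closer. item-stated BY NAME so the route's dependency cone is declared (gate staffable
rule 2026-08-15; director-bsd 2026-08-27T14:28:55Z/14:35:50Z remedy (i); PrintCFram/PrintX9/SOED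
precedent): banked context, never staffed, BC6-exempt, closes only by formalisation; no crux
statement / closes / tribunal change. -/
@[route_item "route-BirchSwinnertonDyer-ShiftedKolyvaginAtInertTwo"]
def TianRankOneShaOdd : Prop :=
  Literature.NumberTheory.EllipticCurves.Tian2014.thm13_rank_one_and_sha_odd

/-- item stmt-BirchSwinnertonDyer-20586 · aside · rank 9 · open · by planner
sources: LiLiuTian2024, LiTianYanZhu2025
[aside] Li–Liu–Tian 2024 Thm 1.2 (= Li–Tian–Yan–Zhu 2025 Thm 1.3) AS PRINTED: full BSD for E_n, n ≡
5, 6, 7 (8) square-free with the printed 4-rank-zero class-group condition (DOSSIER §2/§12 row hLLT: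
VERBATIM; already in the kernel by name as the class leaf `CongruentFamilyLLT`, ty2 p534422),
conjunct 8 of 𝔅_ram — consumed by p1's `…TYZProved_of_facts (… hLLT …)`. item-stated BY NAME so the
route's dependency cone is declared (gate staffable rule 2026-08-15; director-bsd
2026-08-27T14:28:55Z/14:35:50Z remedy (i); PrintCFram/PrintX9/SOED precedent): banked context, never
staffed, BC6-exempt, closes only by formalisation; no crux statement / closes / tribunal change. -/
@[route_item "route-BirchSwinnertonDyer-ShiftedKolyvaginAtInertTwo"]
def LLTCongruentNumberBSD : Prop :=
  Literature.NumberTheory.EllipticCurves.LiLiuTian2024.thm12_bsd_congruentNumberCurve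

/-- item stmt-BirchSwinnertonDyer-20587 · aside · rank 9 · open · by planner
sources: Monsky1990MockHeegner, Monsky1990
[aside] Monsky 1990 (Math. Z. 204, mock Heegner points) Cor 5.15 (2) AS PRINTED: rank E_n(ℚ) = 1 on
the 𝒮⁺ residue families (n = pq …), with the «patient reader» 2-Selmer clause now a tree theorem
(`P2.card_selmerGroup_two_eq_eight_of_isCor515Family`; DOSSIER §12 row hM515: VERBATIM, only debt =
rank exactly one), conjunct 9 of 𝔅_ram — consumed by p1's `…TYZProved_of_facts (… h515 …)` (M35
slice). item-stated BY NAME so the route's dependency cone is declared (gate staffable rule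
2026-08-15; director-bsd 2026-08-27T14:28:55Z/14:35:50Z remedy (i); PrintCFram/PrintX9/SOED
precedent): banked context, never staffed, BC6-exempt, closes only by formalisation; no crux
statement / closes / tribunal change. -/
@[route_item "route-BirchSwinnertonDyer-ShiftedKolyvaginAtInertTwo"]
def MonskyCor515RankOneSelmer : Prop :=
  Literature.NumberTheory.EllipticCurves.Monsky1990.cor515_rank_eq_one_and_card_selmerGroup_two

/-- item stmt-BirchSwinnertonDyer-20589 · aside · rank 9 · open · by planner
sources: Tian2014, doi:10.4171/icm2022/85
[aside] Tian 2014 §3/§5: the 𝒮⁻ CM-point (Euler) system in genus form (tree decl self-declared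
«FLAGGED ASSEMBLY» of Tian's Thm 1.5/5.x inputs; DOSSIER §12 row hTSYS: DISPLAY, LITERAL-by-name;
referee: no closer of record destructures it), conjunct 11 of 𝔅_ram — carried so the BC5 witness
`P2.congruentSilentEvenFiveBSDTwo_of_genusSystem_of_monskyEven` reads inside the bundle. item-stated
BY NAME so the route's dependency cone is declared (gate staffable rule 2026-08-15; director-bsd
2026-08-27T14:28:55Z/14:35:50Z remedy (i); PrintCFram/PrintX9/SOED precedent): banked context, never
staffed, BC6-exempt, closes only by formalisation; no crux statement / closes / tribunal change. -/
@[route_item "route-BirchSwinnertonDyer-ShiftedKolyvaginAtInertTwo"]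
def TianSMinusGenusSystem : Prop :=
  Literature.NumberTheory.EllipticCurves.Tian2014.tian2014_system_sMinus_genus

/-- item stmt-BirchSwinnertonDyer-20590 · aside · rank 9 · open · by planner
sources: KrizLi2019, doi:10.1017/fms.2019.9
[aside] Kriz–Li 2019 (FMS 7) Thm 1.12 / Thm 5.1 (2) AS PRINTED: 2-part of BSD transported from a
base curve with E(ℚ)[2] = 0 (and the printed (★) normalisation) to its quadratic twists in the
prescribed congruence classes (DOSSIER §4/§12 row hKL: VERBATIM with two disclosed glosses),
conjunct 5 of 𝔅_inert and of 𝔅_split — the second inert road (j = 0 non-cube sextics, odd Heegner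
fields; p3 g2) and the only printed lever toward the split-bad residual. item-stated BY NAME so the
route's dependency cone is declared (gate staffable rule 2026-08-15; director-bsd
2026-08-27T14:28:55Z/14:35:50Z remedy (i); PrintCFram/PrintX9/SOED precedent): banked context, never
staffed, BC6-exempt, closes only by formalisation; no crux statement / closes / tribunal change. -/
@[route_item "route-BirchSwinnertonDyer-ShiftedKolyvaginAtInertTwo"]
def KrizLiThm112Twist : Prop :=
  Literature.NumberTheory.EllipticCurves.KrizLi2019.thm112_bsdTwo_twist

/-- item stmt-BirchSwinnertonDyer-20591 · aside · rank 9 · open · by planner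
sources: ShuZhai2021, arXiv:2102.11808
[aside] Shu–Zhai 2021 (Crelle 775; arXiv:2102.11808) Thm 1.2 AS PRINTED (generalized Birch lemma:
ord_{s=1} L(E^{(−pM)},s) = 1 = rank for the admissible twists of an optimal E with the printed
datum), conjunct 6 of 𝔅_inert — consumed by p3's `P2.cornerFTwo_shuZhaiThirtySix_byName (h12 h14 …)`
(36a1 slice, leaf `WAllCornerFTwoInertShuZhaiThirtySix`). DOSSIER §3/§12 row hSZ12: VERBATIM.
item-stated BY NAME so the route's dependency cone is declared (gate staffable rule 2026-08-15;
director-bsd 2026-08-27T14:28:55Z/14:35:50Z remedy (i); PrintCFram/PrintX9/SOED precedent): banked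
context, never staffed, BC6-exempt, closes only by formalisation; no crux statement / closes /
tribunal change. -/
@[route_item "route-BirchSwinnertonDyer-ShiftedKolyvaginAtInertTwo"]
def ShuZhaiThm12Ranks : Prop :=
  Literature.NumberTheory.EllipticCurves.ShuZhai2021.thm12_ranks_of_twists

/-- item stmt-BirchSwinnertonDyer-20592 · aside · rank 9 · open · by planner
sources: ShuZhai2021, arXiv:2102.11808
[aside] Shu–Zhai 2021 Thm 1.4 AS PRINTED: the 2-part of BSD for the twists of Thm 1.2 relative to
the 2-part of BSD of the base curve (DOSSIER §3/§12 row hSZ14: VERBATIM; Ω = Ω⁺ or 2Ω⁺ «the one in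
the exact formula», p.6 L36), conjunct 7 of 𝔅_inert — consumed by p3's 36a1 closers. item-stated BY
NAME so the route's dependency cone is declared (gate staffable rule 2026-08-15; director-bsd
2026-08-27T14:28:55Z/14:35:50Z remedy (i); PrintCFram/PrintX9/SOED precedent): banked context, never
staffed, BC6-exempt, closes only by formalisation; no crux statement / closes / tribunal change. -/
@[route_item "route-BirchSwinnertonDyer-ShiftedKolyvaginAtInertTwo"]
def ShuZhaiThm14TwoPartBSD : Prop :=
  Literature.NumberTheory.EllipticCurves.ShuZhai2021.thm14_twoPartBSD_of_twists

/-- item stmt-BirchSwinnertonDyer-20593 · aside · rank 9 · open · by planner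
sources: ShuZhai2021, arXiv:2102.11808
[aside] Shu–Zhai 2021 Thm 4.10 AS PRINTED (2-adic valuations of the toric periods / L-values of the
twists; DOSSIER §3/§12 row hSZ410: VERBATIM), conjunct 8 of 𝔅_inert — carried with Thm 1.2/1.4 for
the explicit-family closers. item-stated BY NAME so the route's dependency cone is declared (gate
staffable rule 2026-08-15; director-bsd 2026-08-27T14:28:55Z/14:35:50Z remedy (i);
PrintCFram/PrintX9/SOED precedent): banked context, never staffed, BC6-exempt, closes only by
formalisation; no crux statement / closes / tribunal change. -/
@[route_item "route-BirchSwinnertonDyer-ShiftedKolyvaginAtInertTwo"]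
def ShuZhaiThm410Valuations : Prop :=
  Literature.NumberTheory.EllipticCurves.ShuZhai2021.thm410_twoAdicValuations_of_twists

/-- item stmt-BirchSwinnertonDyer-24148 · support · rank 9 · open · by planner
sources: GrossZagier1986
[support] Gross–Zagier formula at every level N (named Literature fact `gross_zagier`, cite-level T0
debt; head constant so the route closes BY NAME). Source: GrossZagier1986. -/
@[route_item "route-BirchSwinnertonDyer-ShiftedKolyvaginAtInertTwo", crux]
def GrossZagierAllLevels : Prop :=
  ∀ (N : ℕ) [NeZero N] (W : WeierstrassCurve ℚ) (K : Type) [Field K] [NumberField K], Literature.NumberTheory.EllipticCurves.gross_zagier N W K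

/-- item stmt-BirchSwinnertonDyer-24149 · support · rank 9 · open · by planner
sources: Milne1972
[support] Milne 1972 Thm 1 (BSD quotient under quadratic base change, any model; named Literature
fact, cite-level; head constant). Source: Milne1972. -/
@[route_item "route-BirchSwinnertonDyer-ShiftedKolyvaginAtInertTwo", crux]
def MilneAnyModel : Prop :=
  Literature.NumberTheory.EllipticCurves.Milne1972.bsdQuotient_baseChange_quadratic_anyModel

/-- item stmt-BirchSwinnertonDyer-25416 · support · rank 9 · closed · proved by Summit.BirchSwinnertonDyer.Rank1Residual.P2.ShiftedSupply.shiftedSupplyAtInertTwo_ofFacts (literature-prover) · by planner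
sources: GrossZagier1986, HoffsteinLuo1997, BCDTJAMS2001
[support] Heegner supply on the shifted habitat RELATIVE TO modularity, Hoffstein–Luo/BFH twist
non-vanishing and Gross–Zagier at all levels: for W on the habitat with analytic rank 1 and any
optimal odd-Manin datum Dt there are a Heegner field K (imaginary quadratic, odd d_K ≠ −3, Heegner
hypothesis for N, d_K·(−|Δ|) and d_K·(−2|Δ|) non-squares), β, ι, a level-1 Kolyvagin–Heegner datum
with y_K non-torsion and exact 2-divisibility exponent M₀, and a globally minimal model of the twist
E^K with CM and analytic rank 0. The sibling's CMPrimitiveSupplyAtInertTwoOfFacts (24649, candidate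
proof attached by -ref g5) minus its Kolyvagin clause; closable now. [difficulty: provable-now] -/
@[route_item "route-BirchSwinnertonDyer-ShiftedKolyvaginAtInertTwo", crux]
def ShiftedSupplyAtInertTwoOfFacts : Prop :=
  (Literature.NumberTheory.EllipticCurves.ModularForms.exists_isNewformOf ∧ Literature.NumberTheory.EllipticCurves.HoffsteinLuo1997_exists_twist_L_one_ne_zero ∧ (∀ (N : ℕ) [NeZero N] (W : WeierstrassCurve ℚ) (K : Type) [Field K] [NumberField K], Literature.NumberTheory.EllipticCurves.gross_zagier N W K)) → ∀ (W : WeierstrassCurve ℚ) [W.IsElliptic] [W.IsGloballyMinimal] [NeZero (W.conductorNorm ℤ)], W.HasCM → Literature.NumberTheory.EllipticCurves.Rank1Residual.CMInert W 2 → W.HasSurjectiveModNGaloisRep (2 : ℤ) → W.analyticRank = 1 → ∀ (Dt : Literature.NumberTheory.EllipticCurves.ModularForms.ModularParametrizationData W (W.conductorNorm ℤ)), (∀ z ∈ Dt.L.lattice, ∃ w ∈ Literature.NumberTheory.EllipticCurves.ModularForms.periodLattice Dt.f, z = (Dt.c : ℂ) * w) → Odd Dt.c → ∃ (K : Type) (_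 : Field K) (_ : NumberField K), Literature.NumberTheory.EllipticCurves.IsImaginaryQuadratic K ∧ Odd (NumberField.discr K) ∧ NumberField.discr K ≠ -3 ∧ Literature.NumberTheory.EllipticCurves.SatisfiesHeegnerHypothesis (W.conductorNorm ℤ) K ∧ ¬ IsSquare ((NumberField.discr K : ℚ) * -|W.Δ|) ∧ ¬ IsSquare ((NumberField.discr K : ℚ) * (-(2 * |W.Δ|))) ∧ ∃ (β : ℤ) (ι : K →+* ℂ) (d₁ : Literature.NumberTheory.EllipticCurves.KolyvaginHeegnerData Dt β ι 1), ¬ IsOfFinAddOrder d₁.derivedPoint ∧ ∃ M₀ : ℕ, (∃ Q : (W.baseChange (Literature.NumberTheory.EllipticCurves.ringClassField K ι 1)).toAffine.Point, ((2 ^ M₀ : ℕ) : ℤ) • Q = d₁.derivedPoint) ∧ (¬ ∃ Q : (W.baseChange (Literature.NumberTheory.EllipticCurves.ringClassField K ι 1)).toAffine.Point, ((2 ^ (M₀ + 1) : ℕ) : ℤ) • Q = d₁.derivedPoint) ∧ ∃ (Wd : WeierstrassCurve ℚ) (_ : Wd.IsElliptic) (_ : Wd.IsGloballyMinimal), (∃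 C : WeierstrassCurve.VariableChange ℚ, C • W.quadraticTwist (NumberField.discr K : ℚ) = Wd) ∧ Wd.HasCM ∧ Wd.analyticRank = 0

/-- `ShiftedSupplyAtInertTwoOfFacts` holds: proved by `Summit.BirchSwinnertonDyer.Rank1Residual.P2.ShiftedSupply.shiftedSupplyAtInertTwo_ofFacts`. -/
theorem ShiftedSupplyAtInertTwoOfFacts_holds : ShiftedSupplyAtInertTwoOfFacts := _root_.Summit.BirchSwinnertonDyer.Rank1Residual.P2.ShiftedSupply.shiftedSupplyAtInertTwo_ofFacts

/-- item stmt-BirchSwinnertonDyer-25527 · aside · rank 9 · closed · proved by Summit.BirchSwinnertonDyer.BirchSwinnertonDyer.Theorems.hbMonskySelmerEven_proof (prover) · by planner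
sources: HeathBrown1994SelmerCongruentII
[aside] Heath-Brown 1994 Appendix (Monsky), even case: #Sel₂ of E_{2m} via the Monsky matrix, AS
PRINTED — item-stated BY NAME so this route's dependency cone is declared (gate staffable rule
2026-08-15; director-bsd 2026-08-27T14:28:55Z remedy (i); PrintCf2 precedent
stmt-BirchSwinnertonDyer-20588, shared by name): the fact is reached through
`PrintCf2ComplementAtTwo` / `PublishedFactsCf2` (PrintCf2's residual classes and fact bundle);
banked context, never staffed, BC6-exempt, closes only by formalisation; no crux statement / closes
/ tribunal change. -/
@[route_item "route-BirchSwinnertonDyer-ShiftedKolyvaginAtInertTwo"]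
def HBMonskySelmerEven : Prop :=
  Literature.NumberTheory.EllipticCurves.HeathBrown1994.monsky_card_selmerGroup_two_even

/-- `HBMonskySelmerEven` holds: proved by `Summit.BirchSwinnertonDyer.BirchSwinnertonDyer.Theorems.hbMonskySelmerEven_proof`. -/
theorem HBMonskySelmerEven_holds : HBMonskySelmerEven := _root_.Summit.BirchSwinnertonDyer.BirchSwinnertonDyer.Theorems.hbMonskySelmerEven_proof

/-- item stmt-BirchSwinnertonDyer-25826 · support · rank 9 · closed · proved by Summit.BirchSwinnertonDyer.Rank1Residual.P2.ShiftedDescent.shiftedExactDescentAtTwo_ofFacts (literature-prover) · by planner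
sources: GrossZagier1986, Gross1991, Milne1972, Miller2011LMS, doi:10.1007/BF01405086
[support, binder of `closes` from rev 5; PROVABLE NOW — turnkey] RELATIVE shifted exact 2-adic
Heegner descent: the four printed inputs (Gross–Zagier at every level, GZK rank = analytic rank ≤ 1,
entire L(E/ℚ,s), Milne 1972 any-model quadratic base change of the BSD quotient) imply
`ShiftedExactDescentAtTwo` (item 25537, now the named conclusion, aside). This is the t-twin of
CMKolyvaginAtInertTwo's PROVED `CMExactDescentAtTwoOfFacts` (stmt-BirchSwinnertonDyer-24154, closer
`cmExactDescentAtTwo_ofFacts`): in `Theorems/CMKolyvaginAtInertTwoCMExactDescentAtTwoGeneral.lean`,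
theorem `bsdp_two_of_card_sha_baseChange_eq_of_facts`, the hypothesis `hT : Odd W.tamagawaProduct`
is used ONLY at `hvcW : padicValRat 2 c_W = 0`; replace it by `t := padicValNat 2 W.tamagawaProduct
≤ M₀` and `hsha : #Ш(E_K)[2^∞] = 2^(2(M₀ − t))`, so `hval : padicValRat 2 q = 2(M₀ − t) = ord₂
#Ш(E_K)` and `MissingPPartOverCAt (W ⊗ K) 2` follows verbatim; then the `_rankOne` wrapper and
`AdditivePotMult.bsdp_of_pPartOverC_baseChange` conclude exactly as at t = 0. Answers tribunal
round-1 T1 finding (25537 as typed is an S-piece; the contentful statement is the relative one) and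
J HYGIENE. Sources: GrossZagier1986 V -/
@[route_item "route-BirchSwinnertonDyer-ShiftedKolyvaginAtInertTwo", crux]
def ShiftedExactDescentAtTwoOfFacts : Prop :=
  ((∀ (N : ℕ) [NeZero N] (W : WeierstrassCurve ℚ) (K : Type) [Field K] [NumberField K], Literature.NumberTheory.EllipticCurves.gross_zagier N W K) ∧ Literature.NumberTheory.EllipticCurves.rank_eq_analyticRank_of_analyticRank_le_one ∧ WeierstrassCurve.hasEntireLFunction_rat ∧ Literature.NumberTheory.EllipticCurves.Milne1972.bsdQuotient_baseChange_quadratic_anyModel) → ShiftedExactDescentAtTwo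

/-- `ShiftedExactDescentAtTwoOfFacts` holds: proved by `Summit.BirchSwinnertonDyer.Rank1Residual.P2.ShiftedDescent.shiftedExactDescentAtTwo_ofFacts`. -/
theorem ShiftedExactDescentAtTwoOfFacts_holds : ShiftedExactDescentAtTwoOfFacts := _root_.Summit.BirchSwinnertonDyer.Rank1Residual.P2.ShiftedDescent.shiftedExactDescentAtTwo_ofFacts

/-- item stmt-BirchSwinnertonDyer-27273 · support · rank 9 · closed · proved by Summit.BirchSwinnertonDyer.BirchSwinnertonDyer.Theorems.ShiftedKolyvaginAtInertTwo.ManinConstantPrimewisePrints_proof (prover) · by planner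
why it might fail: Conjunction of three printed theorems stated verbatim in lattice form (Mazur 1978 Cor 4.1, Abbes–Ullmo 1996 Thm A, Česnavičius 2018 Thm 1.2); fails only if a lattice rendering mis-transcribes the optimality hypothesis Λ_W ⊆ c·Λ_f.
sources: Mazur1978, AbbesUllmo1996, Cesnavicius2018, Edixhoven1991
[support, PRINTED — by-name bundle of three named Literature facts (statement-only, cite-tagged);
binder hMP of `closes` since rev 13; its conjuncts are the head-constant asides
MazurManinConstantOddPrimes / AbbesUllmoManinConstantGoodPrimes / CesnaviciusManinConstantAtTwo (=
items 19383 / 20090 / 20091 of AdditiveKolyvaginRoad, count once)] The three printed prime-by-prime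
Manin-constant theorems in lattice form — Mazur 1978 Cor. 4.1 (odd p, p² ∤ N ⇒ p ∤ c), Abbes–Ullmo
1996 Thm A (p ∤ N ⇒ p ∤ c), Česnavičius 2018 Thm 1.2 (2 ∥ N ⇒ 2 ∤ c) — for lattice-optimal
parametrisation data of globally minimal curves. With modularity (hmod) they give, through ty2 g18's
landed engine `Rank1Residual.P2.OddManinTwistRoad.odd_c_of_latticeOptimal_of_j_oddHeegner hMP.1
hMP.2.1 hMP.2.2 hmod W hj Dt hopt` (P2/CMKolyvaginOddManinTwistRoadAtTwo{,Classes}.lean, p616713 /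
p617449: d ≡ 1 (4) twists are good at 2 ⇒ Abbes–Ullmo; other twists are dyadic twists of a
2-semistable partner ⇒ Mazur/Abbes–Ullmo/Česnavičius on the partner + cell bsd-f2-manin's PROVED η =
2 law `Theorems.twoNotDvdManinOfTwistOfSemistableAtTwo_holds`), Odd Dt.c for EVERY lattice-optimal
datum at the conductor on the five odd-Heegner -/
@[route_item "route-BirchSwinnertonDyer-ShiftedKolyvaginAtInertTwo", crux]
def ManinConstantPrimewisePrints : Prop :=
  Literature.NumberTheory.EllipticCurves.ModularForms.mazur_not_dvd_maninConstant_of_odd ∧ Literature.NumberTheory.EllipticCurves.ModularForms.abbesUllmo_not_dvd_maninConstant_of_not_dvd_level ∧ Literature.NumberTheory.EllipticCurves.ModularForms.cesnavicius_not_two_dvd_maninConstant_of_two_dvd_level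

-- `ManinConstantPrimewisePrints` holds: proved by `Summit.BirchSwinnertonDyer.BirchSwinnertonDyer.Theorems.ShiftedKolyvaginAtInertTwo.ManinConstantPrimewisePrints_proof` (its module imports this route file, so no `_holds` link can be stated here).

-- earlier Assembly (stmt-BirchSwinnertonDyer-25417, replaced 2026-08-28T08:25:46Z -> stmt-BirchSwinnertonDyer-26954): retired by None — RefinedKolyvaginAtInertTwo → ShiftedKolyvaginExactAtInertTwo → ShiftedExactDescentAtTwo → OddManinCMInertTwo → PrintCf2ComplementAtTwo → ShiftedSupplyAtInertTwoOfFacts → ModularityExistsNewform → HoffsteinLuoTwist → GrossZagierAllLevels → CMRankZeroBSDTriple → Entir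
-- earlier Assembly (stmt-BirchSwinnertonDyer-26954, replaced 2026-08-28T09:30:16Z -> stmt-BirchSwinnertonDyer-27272): retired by None — RefinedKolyvaginAtInertTwo → ShiftedKolyvaginExactAtInertTwo → ShiftedExactDescentAtTwoOfFacts → OddManinCMInertTwoR → PrintCf2ComplementAtTwo → ShiftedSupplyAtInertTwoOfFacts → ModularityExistsNewform → HoffsteinLuoTwist → GrossZagierAllLevels → MilneAnyModel → CMR
/-- item stmt-BirchSwinnertonDyer-27272 · assembly · rank 1 · closed · proved by Summit.BirchSwinnertonDyer.BirchSwinnertonDyer.Theorems.ShiftedKolyvaginAtInertTwo.assembly_proof (prover) · by planner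
sources: Kolyvagin1991, Gross1991, arXiv:2312.09301
[assembly] The deciding implication in the exact binder order of `closes` (rev 15):
RefinedKolyvaginAtInertTwo → ShiftedKolyvaginExactAtInertTwo → ShiftedExactDescentAtTwoOfFacts →
PrintCf2ComplementAtTwo → ShiftedSupplyAtInertTwoOfFacts → ModularityExistsNewform →
HoffsteinLuoTwist → GrossZagierAllLevels → MilneAnyModel → ManinConstantPrimewisePrints →
CMRankZeroBSDTriple → EntireLFunctionRat → PublishedFactsCf2 → WAllCornerFTwo; literally the type of
`closes`, so `theorem Assembly_holds : Assembly := closes` proves it (rev 15: the Manin crux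
OddManinCMInertTwoR dropped, its binder replaced by the by-name bundle ManinConstantPrimewisePrints
of the three printed Manin facts; rev 12 chain superseded). -/
@[route_item "route-BirchSwinnertonDyer-ShiftedKolyvaginAtInertTwo"]
def Assembly : Prop :=
  RefinedKolyvaginAtInertTwo → ShiftedKolyvaginExactAtInertTwo → ShiftedExactDescentAtTwoOfFacts → PrintCf2ComplementAtTwo → ShiftedSupplyAtInertTwoOfFacts → ModularityExistsNewform → HoffsteinLuoTwist → GrossZagierAllLevels → MilneAnyModel → ManinConstantPrimewisePrints → CMRankZeroBSDTriple → EntireLFunctionRat → PublishedFactsCf2 → Summit.BirchSwinnertonDyer.WAllCornerFTwo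

-- `Assembly` holds: proved by `Summit.BirchSwinnertonDyer.BirchSwinnertonDyer.Theorems.ShiftedKolyvaginAtInertTwo.assembly_proof` (its module imports this route file, so no `_holds` link can be stated here).

-- records of items no longer active in this route (dropped / restated):
-- earlier OddManinCMInertTwo (stmt-BirchSwinnertonDyer-25414, replaced 2026-08-28T07:49:35Z -> stmt-BirchSwinnertonDyer-26780): retired by None — ∀ (W : WeierstrassCurve ℚ) [W.IsElliptic] [W.IsGloballyMinimal] [NeZero (W.conductorNorm ℤ)], W.HasCM → Literature.NumberTheory.EllipticCurves.Rank1Residual.CMInert W 2 → W.HasSurjectiveModNGaloisRep (2 : ℤ) → W.analyticRank = 1 → ∃ Dt : Literature.NumberT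

/-! D-0027 §2.1 — DECIDING THEOREM (planner-authored via `route open/edit --closes-file`; by planner-bsd-print-cf2-plan-g7-0 2026-08-28T09:30:16Z):
its hypotheses are this route's items and its conclusion the registered leaf `Summit.BirchSwinnertonDyer.WAllCornerFTwo` (rung W-ALL/12.K12-2, D-0061) (glue_lint), and it elaborates with this file. -/

@[closes "route-BirchSwinnertonDyer-ShiftedKolyvaginAtInertTwo"] theorem closes (hA : RefinedKolyvaginAtInertTwo) (hB : ShiftedKolyvaginExactAtInertTwo)
    (hCf : ShiftedExactDescentAtTwoOfFacts)
    (hRes : PrintCf2ComplementAtTwo) (hSup : ShiftedSupplyAtInertTwoOfFacts)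
    (hmod : ModularityExistsNewform) (hHL : HoffsteinLuoTwist) (hGZ : GrossZagierAllLevels)
    (hMi : MilneAnyModel)
    (hMP : ManinConstantPrimewisePrints)
    (hBF : CMRankZeroBSDTriple) (hL : EntireLFunctionRat) (hF : PublishedFactsCf2) :
    Summit.BirchSwinnertonDyer.WAllCornerFTwo := by
  have hC : ShiftedExactDescentAtTwo := hCf ⟨hGZ, hF.2.1, hL, hMi⟩
  obtain ⟨hR, hJ0, hS⟩ := hRes
  refine Summit.BirchSwinnertonDyer.BirchSwinnertonDyer.Theses.PrintCf2.closes hR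
    (Summit.BirchSwinnertonDyer.BirchSwinnertonDyer.Theorems.inertTwoRankOneOfFactsGlue_proof hJ0 ?_) hS hF
  intro hBI W _ _ hr hj
  refine Summit.BirchSwinnertonDyer.Rank1Residual.P2.OptimalPartner.bsdp_of_forall_optimal_of_j_oddHeegner
    hBI.2.2.1 hBI.1 hBI.2.1 hmod 2 ?_ W hr hj
  intro W _ _ _ Dt hoptDt hr hj
  obtain ⟨hcm, hin, hρ, _ht⟩ :=
    Summit.BirchSwinnertonDyer.Rank1Residual.P2.OddHeegnerTwists.shiftedHabitat_of_j_oddHeegner W hj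
  have hc : Odd Dt.c :=
    Summit.BirchSwinnertonDyer.Rank1Residual.P2.OddManinTwistRoad.odd_c_of_latticeOptimal_of_j_oddHeegner
      hMP.1 hMP.2.1 hMP.2.2 hmod W hj Dt hoptDt
  obtain ⟨K, _, _, hIQ, hodd, h3, hHe, hsq1, hsq2, β, ι, d₁, hy, M₀, hdiv, hndiv, Wd, _, _, hWd, hcmd, hrd⟩ :=
    hSup ⟨hmod, hHL, hGZ⟩ W hcm hin hρ hr Dt hoptDt hc
  obtain ⟨hge, n, d, hn, hKoly, hMn, hPn⟩ := hA W hcm hin hρ hr K hIQ hodd h3 hHe Dt hoptDt hc β ι d₁ hy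
  have hex := hB W hcm hin hρ K hIQ hodd h3 hHe hsq1 hsq2 Dt β ι d₁ hy M₀ hdiv hndiv hge n d hn hKoly hMn hPn
  have hBd : Literature.NumberTheory.EllipticCurves.BSDp Wd 2 :=
    Summit.BirchSwinnertonDyer.Rank1Residual.bsdp_cm_rankZero (p := 2) hBF hL hcmd hrd
  exact hC W hcm hin hρ hr K hIQ hodd h3 hHe Dt hoptDt hc β ι d₁ hy M₀ hdiv hndiv hex.1 hex.2 Wd hWd hBd

end Summit.BirchSwinnertonDyer.BirchSwinnertonDyer.Theses.ShiftedKolyvaginAtInertTwo
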